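import Literature.NumberTheory.LFunctions.TaoLogElliottCMization
import Literature.NumberTheory.Sieve.MatomakiRadziwill
import Literature.NumberTheory.LFunctions.PrimeReciprocalWindows
import Mathlib.NumberTheory.Harmonic.Bounds
import Mathlib.Analysis.SpecialFunctions.Pow.Real
import HarnessLib

/-!
# Tao's log-averaged Elliott theorem: Proposition 2.1 (reduction to unimodular `g₁, g₂`)

Fifth layer of the proof DAG below the named fact `Literature.NumberTheory.LFunctions.tao_log_averaged_elliott_two`
(Tao, Forum Math. Pi 4 (2016) e8, Theorem 1.3), on top of `TaoLogElliottCMization.lean`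
(Proposition 2.2, proved there).  `TaoLogElliottSection2.lean` records the printed steps of §2 as named facts;
here the two steps of Proposition 2.1 are treated, following the printed proof:

* `Literature.Tao2016_prop21_right_holds : Tao2016_prop21_right` — PROVED outright: Theorem 1.3 for
  `S¹`-valued `g₁, g₂` implies Theorem 1.3 for `S¹`-valued `g₁` and arbitrary `g₂` (the sentence
  following the proof of Prop. 2.1).  Randomising `g₂` does not touch hypothesis (1.5), so the
  averaging argument needs neither Halász's inequality nor Markov's inequality
  (`Literature.NumberTheory.LFunctions.Tao2016_theorem13For.of_circleValued_right`).
* `Literature.Tao2016_prop21_of_halasz : Parity.halaszMontgomeryTenenbaum → Tao2016_prop21` — PROVED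
  from the named fact recording Halász's inequality (`Literature/NumberTheory/Sieve/
  MatomakiRadziwill.lean`), which is the input the paper cites ("Applying the Halasz inequality
  (see e.g. [Tenenbaum] or [Granville–Soundararajan])").  More precisely the proof only uses the
  mean value bound `Literature.Tao2016.AbsMeanValueBound C` for the moduli `|g|` of multiplicative
  functions (`∑_{n ≤ y} |g(n)| ≤ C y ((2 + D) e^{-D} + 1/log y)` whenever
  `D ≤ ∑_{p ≤ y} (1 - |g(p)|)/p`), through `Literature.NumberTheory.LFunctions.Tao2016_prop21_of_mv`; Halász's inequality gives it
  (`absMeanValueBound_of_halasz`), and so would the elementary Hall–Tenenbaum upper bound for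
  nonnegative multiplicative functions.
* `Literature.NumberTheory.LFunctions.Tao2016_section2_reduction_of_halasz`, `Literature.NumberTheory.LFunctions.tao_log_averaged_elliott_two_of_halasz` —
  assembly with `Tao2016_prop22_holds`, `Tao2016_prop22_right_holds` (`TaoLogElliottCMization.lean`):
  Halász's inequality and Theorem 2.3 imply Theorem 1.3; the `…_of_mv` variants take the mean
  value bound instead.

Contents of the machinery (namespace `Literature.Tao2016`, all proved):

* `unitC z` (`z/|z|`), `absPart g = |g|` (multiplicative);
* a finite random model without measure theory: outcomes `ω ⊆ U = [1, N]` (the coordinates with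
  sign `-1`), signs `sgn ω q = ∓1`, weights `wt θ U ω = ∏_{q ∈ ω} (1-θ q)/2 ∏_{q ∈ U∖ω} (1+θ q)/2`,
  the product formula `sum_wt_mul_prod` (independence, from `Finset.prod_add`), total mass
  `sum_wt_eq_one`, means `sum_wt_mul_sgn`, Markov's inequality `sum_wt_filter_le`;
* the random unimodular multiplicative function `randModel g ω`
  (`𝐠_ω(p^j) = sgn_ω(p^j) unitC(g(p^j))`), its mean `sum_wt_mul_randModel : 𝔼 𝐠_ω(n) = g(n)`
  (`1 ≤ n ≤ N`), and the linearity identities `sum_wt_mul_logCorrelation_left/right`;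
* the deficiencies `modulusDist g x = 𝔻(|g|, 1; x)² = ∑_{p ≤ x} (1 - |g p|)/p`,
  `signDist ω x = 𝔻(sgn_ω, 1; x)² = ∑_{p ≤ x} (1 - sgn_ω p)/p` (both instances of the tree's
  `Literature.NumberTheory.Sieve.pretentiousDistSq`; `𝔼 signDist = modulusDist`), the comparison
  `pretentiousDistSq_randModel_ge : 𝔻(𝐠_ω, z)² ≥ 𝔻(g, z)² - Y_ω - D(g)` and the transfer of
  hypothesis (1.5) to `𝐠_ω` at level `A/2` on the event `Y_ω ≤ A₀²` (`nonpretentiousAt_randModel`);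
* Case 1 (`D(g₁; x) ≥ A₀`): `modulusDist_window` (Chebyshev-strength Mertens window bound from
  `PrimeReciprocalWindows`), `sum_norm_div_high_le` (dyadic blocks), `sum_inv_low_le`,
  `case1_bound` (explicit constants), `absMeanValueBound_of_halasz`.

## References
* T. Tao, *The logarithmically averaged Chowla and Elliott conjectures for two-point
  correlations*, Forum Math. Pi 4 (2016), e8; arXiv:1509.05422, §2, Proposition 2.1, its proof,
  and the sentence following the proof.

## Design choices / deviations from the printed argument
* The paper's random multiplicative `𝐠'₁ ∈ {±1}` with independent values at prime powers and
  `𝔼 𝐠'₁(p^j) = |g₁(p^j)|` is realised on the finite probability space `𝒫([1, N])`,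
  `N = a₁⌊x⌋ + b₁` (only the prime powers `≤ N` matter); expectations are finite weighted sums and
  `𝐠₁ = 𝐠'₁ g''₁` is built directly at prime powers (`randModel`), so that `g''₁ = g₁/|g₁|` is never
  needed as a separate multiplicative function.
* Constants (for `ε₀ = min(ε,1)`): Markov at `A₀²` with `A₀ ≥ 8/ε₀`; level `A/2` for the
  unimodular case (`A ≥ 2(A₀² + A₀)`); in Case 1 the paper's range `x^{1/A₀} ≤ y ≤ x` is replaced
  by `y ≥ max(8, x^θ)`, `θ = ε₀/32`, the Mertens step by the Chebyshev-strength window bound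
  `∑_{y < p ≤ x} 1/p ≤ 8K + 8` (`log x ≤ K log y`), whence `A₀ ≥ 512/ε₀ + 16`; the trivial bound
  for the exceptional event is `|corr| ≤ 1 + log ω ≤ 2 log ω`.
* `Tao2016_prop21` is obtained here conditionally on the named fact `halaszMontgomeryTenenbaum`
  (Halász's theorem is not yet proved in the tree); the dependence is isolated in
  `AbsMeanValueBound`, see above, which a follow-up file is to establish unconditionally from the
  Hall–Tenenbaum (Halberstam–Richert) upper bound for nonnegative multiplicative functions.
-/

open Finset Complex ArithmeticFunction
open scoped ComplexConjugate

namespace Literature.NumberTheory.LFunctions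

namespace Tao2016

/-! ### Unit complex numbers attached to the values of `g` -/

/-- `unitC z = z / |z|` for `z ≠ 0` and `unitC 0 = 1`: a point of the unit circle with
`|z| · unitC z = z`. [folklore] -/
noncomputable def unitC (z : ℂ) : ℂ := if z = 0 then 1 else z / (‖z‖ : ℂ)

/-- `|unitC z| = 1`. [folklore] -/
theorem norm_unitC (z : ℂ) : ‖unitC z‖ = 1 := by
  unfold unitC
  split_ifs with h
  · simp
  · rw [norm_div, Complex.norm_real, Real.norm_eq_abs, abs_norm, div_self (norm_ne_zero_iff.mpr h)]

/-- `|z| · unitC z = z`. [folklore] -/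
theorem norm_mul_unitC (z : ℂ) : (‖z‖ : ℂ) * unitC z = z := by
  unfold unitC
  split_ifs with h
  · simp [h]
  · have h' : (‖z‖ : ℂ) ≠ 0 := by exact_mod_cast norm_ne_zero_iff.mpr h
    rw [← mul_div_assoc, mul_div_cancel_left₀ _ h']

/-- `unitC z = e^{i arg z}` (Mathlib's polar decomposition `|z| e^{i arg z} = z`,
`Complex.norm_mul_exp_arg_mul_I`, with the same convention at `z = 0`). [folklore] -/
theorem unitC_eq_exp_arg_mul_I (z : ℂ) : unitC z = Complex.exp (Complex.arg z * Complex.I) := by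
  unfold unitC
  split_ifs with h
  · simp [h]
  · have h' : (‖z‖ : ℂ) ≠ 0 := by exact_mod_cast norm_ne_zero_iff.mpr h
    rw [div_eq_iff h', mul_comm]
    exact (Complex.norm_mul_exp_arg_mul_I z).symm

/-! ### The modulus `g' = |g|` as a multiplicative function -/

/-- `g' := |g|`, the modulus of `g` viewed as a (complex-valued) arithmetic function
(Tao 2016, proof of Prop. 2.1: "`g'₁ := |g₁|` taking values in `[0,1]`").
[cite: TaoFMP2016, proof of Proposition 2.1] -/
noncomputable def absPart (g : ArithmeticFunction ℂ) : ArithmeticFunction ℂ :=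
  ⟨fun n => (‖g n‖ : ℂ), by simp⟩

/-- `g'(n) = |g(n)|`. [folklore] -/
@[simp] theorem absPart_apply (g : ArithmeticFunction ℂ) (n : ℕ) :
    absPart g n = (‖g n‖ : ℂ) := rfl

/-- `g'` is multiplicative when `g` is ("`g'₁, g''₁` are multiplicative").
[cite: TaoFMP2016, proof of Proposition 2.1] -/
theorem isMultiplicative_absPart {g : ArithmeticFunction ℂ} (hg : g.IsMultiplicative) :
    (absPart g).IsMultiplicative := by
  refine ⟨by simp [hg.map_one], fun {m n} hmn => ?_⟩
  simp [hg.map_mul_of_coprime hmn]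

/-- `|g'(n)| = |g(n)|`. [folklore] -/
theorem norm_absPart (g : ArithmeticFunction ℂ) (n : ℕ) : ‖absPart g n‖ = ‖g n‖ := by
  simp

/-! ### A finite random model: signs indexed by subsets of the coordinates

The probability space is `U.powerset` for a finite set `U ⊆ ℕ` of coordinates; the outcome
`ω ⊆ U` is the set of coordinates carrying the sign `-1`.  The coordinate `q` is `-1` with
probability `(1 - θ q)/2` and `+1` with probability `(1 + θ q)/2`, independently, so that its
mean is `θ q`; all "expectations" below are the corresponding finite weighted sums. -/

/-- The sign of the coordinate `q` in the outcome `ω`: `-1` if `q ∈ ω`, else `+1`. [folklore] -/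
def sgn (ω : Finset ℕ) (q : ℕ) : ℝ := if q ∈ ω then -1 else 1

/-- `sgn ω q = ±1`, so `|sgn ω q| = 1`. [folklore] -/
theorem abs_sgn (ω : Finset ℕ) (q : ℕ) : |sgn ω q| = 1 := by
  unfold sgn; split_ifs <;> simp

/-- `sgn ω q ≤ 1`. [folklore] -/
theorem sgn_le_one (ω : Finset ℕ) (q : ℕ) : sgn ω q ≤ 1 := by
  unfold sgn; split_ifs <;> norm_num

/-- `‖(sgn ω q : ℂ)‖ = 1`. [folklore] -/
theorem norm_sgn (ω : Finset ℕ) (q : ℕ) : ‖(sgn ω q : ℂ)‖ = 1 := by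
  rw [Complex.norm_real, Real.norm_eq_abs, abs_sgn]

/-- The weight (probability) of the outcome `ω ⊆ U`:
`∏_{q ∈ ω} (1 - θ q)/2 · ∏_{q ∈ U \ ω} (1 + θ q)/2`. [folklore] -/
noncomputable def wt (θ : ℕ → ℝ) (U ω : Finset ℕ) : ℝ :=
  (∏ q ∈ ω, (1 - θ q) / 2) * ∏ q ∈ U \ ω, (1 + θ q) / 2

/-- The weights are nonnegative when `-1 ≤ θ ≤ 1`. [folklore] -/
theorem wt_nonneg {θ : ℕ → ℝ} (h₁ : ∀ q, θ q ≤ 1) (h₂ : ∀ q, -1 ≤ θ q) (U ω : Finset ℕ) :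
    0 ≤ wt θ U ω := by
  unfold wt
  refine mul_nonneg (Finset.prod_nonneg fun q _ => ?_) (Finset.prod_nonneg fun q _ => ?_)
  · linarith [h₁ q]
  · linarith [h₂ q]

/-- **Product formula (independence of the coordinates).**  For `T ⊆ U`,
`𝔼 ∏_{q ∈ T} F_q(sign of q) = ∏_{q ∈ T} 𝔼 F_q(sign of q)`, written out as finite sums:
`∑_{ω ⊆ U} wt(ω) ∏_{q ∈ T} (ψ q if q ∈ ω, else φ q) = ∏_{q ∈ T} ((1-θ q)/2 · ψ q + (1+θ q)/2 · φ q)`.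
[folklore] -/
theorem sum_wt_mul_prod {θ : ℕ → ℝ} {U T : Finset ℕ} (hT : T ⊆ U) (ψ φ : ℕ → ℂ) :
    ∑ ω ∈ U.powerset, (wt θ U ω : ℂ) * ∏ q ∈ T, (if q ∈ ω then ψ q else φ q)
      = ∏ q ∈ T, ((1 - (θ q : ℂ)) / 2 * ψ q + (1 + (θ q : ℂ)) / 2 * φ q) := by
  classical
  set F : ℕ → ℂ := fun q => (1 - (θ q : ℂ)) / 2 * (if q ∈ T then ψ q else 1) with hF
  set G : ℕ → ℂ := fun q => (1 + (θ q : ℂ)) / 2 * (if q ∈ T then φ q else 1) with hG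
  have key := Finset.prod_add F G U
  have lhs : ∏ q ∈ U, (F q + G q)
      = ∏ q ∈ T, ((1 - (θ q : ℂ)) / 2 * ψ q + (1 + (θ q : ℂ)) / 2 * φ q) := by
    rw [← Finset.inter_eq_right.mpr hT, ← Finset.prod_ite_mem]
    refine Finset.prod_congr rfl fun q _ => ?_
    by_cases hq : q ∈ T
    · simp [hF, hG, hq]
    · simp only [hF, hG, hq, if_false, mul_one]
      ring
  rw [← lhs, key]
  refine Finset.sum_congr rfl fun ω hω => ?_
  rw [Finset.mem_powerset] at hω
  have split : ∏ q ∈ T, (if q ∈ ω then ψ q else φ q)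
      = (∏ q ∈ ω, (if q ∈ T then ψ q else 1)) * ∏ q ∈ U \ ω, (if q ∈ T then φ q else 1) := by
    have h1 : ∏ q ∈ T, (if q ∈ ω then ψ q else φ q)
        = ∏ q ∈ U, (if q ∈ T then (if q ∈ ω then ψ q else φ q) else 1) := by
      rw [Finset.prod_ite_mem, Finset.inter_eq_right.mpr hT]
    rw [h1, ← Finset.prod_sdiff hω, mul_comm]
    congr 1
    · refine Finset.prod_congr rfl fun q hq => ?_
      simp [hq]
    · refine Finset.prod_congr rfl fun q hq => ?_
      have : q ∉ ω := (Finset.mem_sdiff.mp hq).2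
      simp [this]
  have hwt : (wt θ U ω : ℂ) = (∏ q ∈ ω, (1 - (θ q : ℂ)) / 2) * ∏ q ∈ U \ ω, (1 + (θ q : ℂ)) / 2 := by
    unfold wt
    push_cast
    rfl
  rw [split, hwt, hF, hG, Finset.prod_mul_distrib, Finset.prod_mul_distrib]
  ring

/-- Total mass one: `∑_{ω ⊆ U} wt(ω) = 1`. [folklore] -/
theorem sum_wt_eq_one (θ : ℕ → ℝ) (U : Finset ℕ) : ∑ ω ∈ U.powerset, wt θ U ω = 1 := by
  have h := sum_wt_mul_prod (θ := θ) (Finset.empty_subset U) (fun _ => 1) (fun _ => 1)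
  simp only [Finset.prod_empty, mul_one] at h
  exact_mod_cast h

/-- The mean of one sign: `∑_{ω ⊆ U} wt(ω) sgn_ω(q) = θ q` for `q ∈ U`. [folklore] -/
theorem sum_wt_mul_sgn {θ : ℕ → ℝ} {U : Finset ℕ} {q : ℕ} (hq : q ∈ U) :
    ∑ ω ∈ U.powerset, wt θ U ω * sgn ω q = θ q := by
  have h := sum_wt_mul_prod (θ := θ) (Finset.singleton_subset_iff.mpr hq) (fun _ => -1) (fun _ => 1)
  simp only [Finset.prod_singleton] at h
  have h2 : ∀ ω : Finset ℕ, ((if q ∈ ω then (-1 : ℂ) else 1)) = ((sgn ω q : ℝ) : ℂ) := by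
    intro ω; unfold sgn; split_ifs <;> simp
  simp only [h2] at h
  have h3 : ((1 - (θ q : ℂ)) / 2 * -1 + (1 + (θ q : ℂ)) / 2 * 1) = ((θ q : ℝ) : ℂ) := by
    ring
  rw [h3] at h
  exact_mod_cast h

/-- **Markov's inequality** on the finite probability space: if `Y ≥ 0` has mean at most `m`,
the outcomes with `Y ≥ λ` have total weight at most `m / λ`. [folklore] -/
theorem sum_wt_filter_le {θ : ℕ → ℝ} (h₁ : ∀ q, θ q ≤ 1) (h₂ : ∀ q, -1 ≤ θ q) {U : Finset ℕ}
    {Y : Finset ℕ → ℝ} (hY : ∀ ω, 0 ≤ Y ω) {m lam : ℝ} (hlam : 0 < lam)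
    (hm : ∑ ω ∈ U.powerset, wt θ U ω * Y ω ≤ m) :
    ∑ ω ∈ U.powerset with lam ≤ Y ω, wt θ U ω ≤ m / lam := by
  rw [le_div_iff₀ hlam, Finset.sum_mul]
  calc ∑ ω ∈ U.powerset with lam ≤ Y ω, wt θ U ω * lam
      ≤ ∑ ω ∈ U.powerset with lam ≤ Y ω, wt θ U ω * Y ω :=
        Finset.sum_le_sum fun ω hω =>
          mul_le_mul_of_nonneg_left (Finset.mem_filter.mp hω).2 (wt_nonneg h₁ h₂ U ω)
    _ ≤ ∑ ω ∈ U.powerset, wt θ U ω * Y ω :=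
        Finset.sum_le_sum_of_subset_of_nonneg (Finset.filter_subset _ _)
          fun ω _ _ => mul_nonneg (wt_nonneg h₁ h₂ U ω) (hY ω)
    _ ≤ m := hm

/-- `|𝔼 F| ≤ 𝔼 |F|` on the finite probability space. [folklore] -/
theorem norm_sum_wt_mul_le {θ : ℕ → ℝ} (h₁ : ∀ q, θ q ≤ 1) (h₂ : ∀ q, -1 ≤ θ q) (U : Finset ℕ)
    (F : Finset ℕ → ℂ) :
    ‖∑ ω ∈ U.powerset, (wt θ U ω : ℂ) * F ω‖ ≤ ∑ ω ∈ U.powerset, wt θ U ω * ‖F ω‖ := by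
  refine (norm_sum_le _ _).trans (le_of_eq (Finset.sum_congr rfl fun ω _ => ?_))
  rw [norm_mul, Complex.norm_real, Real.norm_of_nonneg (wt_nonneg h₁ h₂ U ω)]

/-! ### The random multiplicative function `𝐠_ω`

`𝐠_ω(p^j) := sgn_ω(p^j) · unitC (g(p^j))`, extended multiplicatively; with `θ(q) = |g(q)|` the
mean of `𝐠_ω(n)` is `∏_{p^j ‖ n} |g(p^j)| unitC(g(p^j)) = g(n)` (Tao 2016, proof of Prop. 2.1:
"a random multiplicative function `𝐠'₁` taking values in `{-1,+1}`, such that the values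
`𝐠'₁(p^j)` at prime powers are jointly independent and have mean `g'₁(p^j)` … set
`𝐠₁ := 𝐠'₁ g''₁`"). -/

/-- The random unimodular multiplicative function `𝐠_ω = 𝐠'_ω · g''` attached to the outcome `ω`
(product over `p^j ‖ n` of `sgn_ω(p^j) · unitC(g(p^j))`; `𝐠_ω(0) = 0`).
[cite: TaoFMP2016, proof of Proposition 2.1] -/
noncomputable def randModel (g : ArithmeticFunction ℂ) (ω : Finset ℕ) : ArithmeticFunction ℂ where
  toFun n := if n = 0 then 0 else n.factorization.prod fun p j => (sgn ω (p ^ j) : ℂ) * unitC (g (p ^ j))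
  map_zero' := by simp

variable (g : ArithmeticFunction ℂ) (ω : Finset ℕ)

/-- The defining formula of `𝐠_ω(n)` for `n ≠ 0`. [folklore] -/
theorem randModel_apply_ne_zero {n : ℕ} (hn : n ≠ 0) :
    randModel g ω n = n.factorization.prod fun p j => (sgn ω (p ^ j) : ℂ) * unitC (g (p ^ j)) := by
  simp [randModel, hn]

/-- `𝐠_ω(1) = 1`. [folklore] -/
@[simp] theorem randModel_one : randModel g ω 1 = 1 := by
  rw [randModel_apply_ne_zero g ω one_ne_zero, Nat.factorization_one, Finsupp.prod_zero_index]

/-- `𝐠_ω(mn) = 𝐠_ω(m) 𝐠_ω(n)` for coprime `m, n`. [folklore] -/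
theorem randModel_mul_of_coprime {m n : ℕ} (hmn : m.Coprime n) :
    randModel g ω (m * n) = randModel g ω m * randModel g ω n := by
  rcases eq_or_ne m 0 with rfl | hm
  · simp [randModel]
  rcases eq_or_ne n 0 with rfl | hn
  · simp [randModel]
  rw [randModel_apply_ne_zero g ω hm, randModel_apply_ne_zero g ω hn,
    randModel_apply_ne_zero g ω (mul_ne_zero hm hn), Nat.factorization_mul hm hn,
    Finsupp.prod_add_index_of_disjoint]
  rw [Nat.support_factorization, Nat.support_factorization]
  exact hmn.disjoint_primeFactors

/-- `𝐠_ω` is multiplicative ("a random multiplicative function").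
[cite: TaoFMP2016, proof of Proposition 2.1] -/
theorem isMultiplicative_randModel : (randModel g ω).IsMultiplicative :=
  ⟨randModel_one g ω, fun hmn => randModel_mul_of_coprime g ω hmn⟩

/-- `𝐠_ω(p^j) = sgn_ω(p^j) unitC(g(p^j))` for `j ≥ 1`. [folklore] -/
theorem randModel_prime_pow {p j : ℕ} (hp : p.Prime) (hj : j ≠ 0) :
    randModel g ω (p ^ j) = (sgn ω (p ^ j) : ℂ) * unitC (g (p ^ j)) := by
  rw [randModel_apply_ne_zero g ω (pow_ne_zero j hp.ne_zero), hp.factorization_pow, Finsupp.prod,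
    Finsupp.support_single _ hj, Finset.prod_singleton, Finsupp.single_eq_same]

/-- `𝐠_ω(p) = sgn_ω(p) unitC(g(p))`. [folklore] -/
theorem randModel_prime {p : ℕ} (hp : p.Prime) :
    randModel g ω p = (sgn ω p : ℂ) * unitC (g p) := by
  simpa using randModel_prime_pow g ω hp one_ne_zero

/-- `|𝐠_ω(n)| = 1` for `n ≥ 1` ("taking values in `S¹`"). [cite: TaoFMP2016, proof of Proposition 2.1] -/
theorem norm_randModel {n : ℕ} (hn : n ≠ 0) : ‖randModel g ω n‖ = 1 := by
  rw [randModel_apply_ne_zero g ω hn, Finsupp.prod, norm_prod]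
  refine Finset.prod_eq_one fun p _ => ?_
  rw [norm_mul, norm_sgn, norm_unitC, one_mul]

/-- `|𝐠_ω(n)| ≤ 1` for all `n`. [folklore] -/
theorem norm_randModel_le_one (n : ℕ) : ‖randModel g ω n‖ ≤ 1 := by
  rcases eq_or_ne n 0 with rfl | hn
  · simp
  · exact (norm_randModel g ω hn).le

/-- `𝐠_ω` is `S¹`-valued in the sense of `Literature.NumberTheory.LFunctions.IsCircleValued`. [folklore] -/
theorem isCircleValued_randModel : IsCircleValued (randModel g ω) :=
  fun _ hn => norm_randModel g ω hn

/-- **The mean of the random model is `g`**: for multiplicative `g` and `1 ≤ n ≤ N`,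
`∑_{ω ⊆ [1, N]} wt(ω) 𝐠_ω(n) = g(n)` when the sign at `q` has mean `|g(q)|`
("By multiplicativity and joint independence, we thus have `𝔼 𝐠'₁(n) = g'₁(n)`").
[cite: TaoFMP2016, proof of Proposition 2.1] -/
theorem sum_wt_mul_randModel (hg : g.IsMultiplicative) {N n : ℕ} (hn : n ≠ 0) (hnN : n ≤ N) :
    ∑ ω ∈ (Icc 1 N).powerset, (wt (fun q => ‖g q‖) (Icc 1 N) ω : ℂ) * randModel g ω n = g n := by
  classical
  -- the prime powers `p^{v_p(n)}` exactly dividing `n`, as a subset `T ⊆ [1, N]`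
  set e : ℕ → ℕ := fun p => p ^ n.factorization p with he
  have hinj : Set.InjOn e n.primeFactors := by
    intro p hp p' hp' hpp'
    have hp1 := Nat.prime_of_mem_primeFactors hp
    have hp1' := Nat.prime_of_mem_primeFactors hp'
    have hk : n.factorization p ≠ 0 :=
      Finsupp.mem_support_iff.mp (by rwa [Nat.support_factorization])
    have h1 : p ∣ e p' := by
      rw [← hpp']
      exact dvd_pow_self p hk
    exact (Nat.prime_dvd_prime_iff_eq hp1 hp1').mp (hp1.dvd_of_dvd_pow h1)
  set T : Finset ℕ := n.primeFactors.image e with hT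
  have hTU : T ⊆ Icc 1 N := by
    intro q hq
    obtain ⟨p, hp, rfl⟩ := Finset.mem_image.mp hq
    have hp1 := Nat.prime_of_mem_primeFactors hp
    rw [Finset.mem_Icc]
    refine ⟨Nat.one_le_iff_ne_zero.mpr (pow_ne_zero _ hp1.ne_zero), le_trans ?_ hnN⟩
    exact Nat.le_of_dvd (Nat.pos_of_ne_zero hn) (Nat.ordProj_dvd n p)
  -- `𝐠_ω(n)` as a product over `T`
  have hrm : ∀ ω, randModel g ω n
      = ∏ q ∈ T, (if q ∈ ω then -unitC (g q) else unitC (g q)) := by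
    intro ω
    rw [randModel_apply_ne_zero g ω hn, Finsupp.prod, Nat.support_factorization, hT,
      Finset.prod_image hinj]
    refine Finset.prod_congr rfl fun p _ => ?_
    unfold sgn
    split_ifs <;> simp [he]
  simp_rw [hrm]
  rw [sum_wt_mul_prod hTU]
  -- the mean of each factor is `|g q| unitC (g q) = g q`
  have hfac : ∀ q : ℕ, ((1 - ((‖g q‖ : ℝ) : ℂ)) / 2 * -unitC (g q)
      + (1 + ((‖g q‖ : ℝ) : ℂ)) / 2 * unitC (g q)) = g q := by
    intro q
    calc _ = ((‖g q‖ : ℝ) : ℂ) * unitC (g q) := by ring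
      _ = g q := norm_mul_unitC (g q)
  simp_rw [hfac]
  rw [hT, Finset.prod_image hinj, hg.multiplicative_factorization _ hn, Finsupp.prod,
    Nat.support_factorization]

/-! ### Linearity of expectation for the correlation -/

/-- The correlation of the random model in the first slot averages to the correlation of `g`
("By linearity of expectation"). [cite: TaoFMP2016, proof of Proposition 2.1] -/
theorem sum_wt_mul_logCorrelation_left (hg : g.IsMultiplicative) (g₂ : ℕ → ℂ) {a₁ : ℕ}
    (ha₁ : 1 ≤ a₁) (b₁ a₂ b₂ : ℕ) (x ω' : ℝ) {N : ℕ} (hN : a₁ * ⌊x⌋₊ + b₁ ≤ N) :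
    ∑ ω ∈ (Icc 1 N).powerset, (wt (fun q => ‖g q‖) (Icc 1 N) ω : ℂ) *
        logCorrelation (randModel g ω) g₂ a₁ b₁ a₂ b₂ x ω'
      = logCorrelation g g₂ a₁ b₁ a₂ b₂ x ω' := by
  unfold logCorrelation
  simp_rw [Finset.mul_sum]
  rw [Finset.sum_comm]
  refine Finset.sum_congr rfl fun n hn => ?_
  have hn1 : 1 ≤ n := by have := (Finset.mem_Ioc.mp hn).1; omega
  have h1 : a₁ * n + b₁ ≠ 0 := by
    have : 1 ≤ a₁ * n := Nat.one_le_iff_ne_zero.mpr (Nat.mul_ne_zero (by omega) (by omega))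
    omega
  have h2 : a₁ * n + b₁ ≤ N :=
    le_trans (Nat.add_le_add_right (Nat.mul_le_mul_left _ (Finset.mem_Ioc.mp hn).2) _) hN
  have h3 : ∀ ω : Finset ℕ, (wt (fun q => ‖g q‖) (Icc 1 N) ω : ℂ) *
      (randModel g ω (a₁ * n + b₁) * g₂ (a₂ * n + b₂) / (n : ℂ))
      = (wt (fun q => ‖g q‖) (Icc 1 N) ω : ℂ) * randModel g ω (a₁ * n + b₁) *
        (g₂ (a₂ * n + b₂) / (n : ℂ)) := fun ω => by ring
  simp_rw [h3]
  rw [← Finset.sum_mul, sum_wt_mul_randModel g hg h1 h2]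
  ring

/-- The correlation of the random model in the second slot averages to the correlation of `g`.
[cite: TaoFMP2016, proof of Proposition 2.1 (the `g₂`-analogue)] -/
theorem sum_wt_mul_logCorrelation_right (hg : g.IsMultiplicative) (g₁ : ℕ → ℂ) (a₁ b₁ : ℕ)
    {a₂ : ℕ} (ha₂ : 1 ≤ a₂) (b₂ : ℕ) (x ω' : ℝ) {N : ℕ} (hN : a₂ * ⌊x⌋₊ + b₂ ≤ N) :
    ∑ ω ∈ (Icc 1 N).powerset, (wt (fun q => ‖g q‖) (Icc 1 N) ω : ℂ) *
        logCorrelation g₁ (randModel g ω) a₁ b₁ a₂ b₂ x ω'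
      = logCorrelation g₁ g a₁ b₁ a₂ b₂ x ω' := by
  unfold logCorrelation
  simp_rw [Finset.mul_sum]
  rw [Finset.sum_comm]
  refine Finset.sum_congr rfl fun n hn => ?_
  have hn1 : 1 ≤ n := by have := (Finset.mem_Ioc.mp hn).1; omega
  have h1 : a₂ * n + b₂ ≠ 0 := by
    have : 1 ≤ a₂ * n := Nat.one_le_iff_ne_zero.mpr (Nat.mul_ne_zero (by omega) (by omega))
    omega
  have h2 : a₂ * n + b₂ ≤ N :=
    le_trans (Nat.add_le_add_right (Nat.mul_le_mul_left _ (Finset.mem_Ioc.mp hn).2) _) hN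
  have h3 : ∀ ω : Finset ℕ, (wt (fun q => ‖g q‖) (Icc 1 N) ω : ℂ) *
      (g₁ (a₁ * n + b₁) * randModel g ω (a₂ * n + b₂) / (n : ℂ))
      = (wt (fun q => ‖g q‖) (Icc 1 N) ω : ℂ) * randModel g ω (a₂ * n + b₂) *
        (g₁ (a₁ * n + b₁) / (n : ℂ)) := fun ω => by ring
  simp_rw [h3]
  rw [← Finset.sum_mul, sum_wt_mul_randModel g hg h1 h2]
  ring

/-! ### The deficiency `∑_{p ≤ x} (1 - |g(p)|)/p` and its random version -/

/-- `D(g; x) := ∑_{p ≤ x} (1 - |g(p)|)/p` (Tao 2016, proof of Prop. 2.1: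
"`∑_{p ≤ x} (1 - g'₁(p))/p`" with `g'₁ = |g₁|`). [cite: TaoFMP2016, proof of Proposition 2.1] -/
noncomputable def modulusDist (g : ArithmeticFunction ℂ) (x : ℝ) : ℝ :=
  Sieve.pretentiousDistSq (absPart g) (fun _ => 1) x

/-- `D(g; x)` is the pretentious distance `𝔻(|g|, 1; x)²` (`Literature.NumberTheory.Sieve.pretentiousDistSq`), by
definition. [folklore] -/
theorem modulusDist_eq_pretentiousDistSq (g : ArithmeticFunction ℂ) (x : ℝ) :
    modulusDist g x = Sieve.pretentiousDistSq (absPart g) (fun _ => 1) x := rfl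

/-- `D(g; x) = ∑_{p ≤ x} (1 - |g(p)|)/p`, the printed form. [cite: TaoFMP2016, proof of Proposition 2.1] -/
theorem modulusDist_eq_sum (g : ArithmeticFunction ℂ) (x : ℝ) :
    modulusDist g x = ∑ p ∈ Nat.primesLE ⌊x⌋₊, (1 - ‖g p‖) / p := by
  unfold modulusDist Sieve.pretentiousDistSq
  refine Finset.sum_congr rfl fun p _ => ?_
  simp

/-- `D(g; x) ≥ 0` for `1`-bounded `g` (`pretentiousDistSq_nonneg`). [folklore] -/
theorem modulusDist_nonneg {g : ArithmeticFunction ℂ} (hb : ∀ n, ‖g n‖ ≤ 1) (x : ℝ) :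
    0 ≤ modulusDist g x :=
  Sieve.pretentiousDistSq_nonneg (fun n => by rw [norm_absPart]; exact hb n) (fun _ => by simp) x

/-- `D(g; ·)` is monotone for `1`-bounded `g` (`pretentiousDistSq_mono`). [folklore] -/
theorem modulusDist_mono {g : ArithmeticFunction ℂ} (hb : ∀ n, ‖g n‖ ≤ 1) {x y : ℝ} (hxy : x ≤ y) :
    modulusDist g x ≤ modulusDist g y :=
  Sieve.pretentiousDistSq_mono (fun n => by rw [norm_absPart]; exact hb n) (fun _ => by simp) hxy

/-- The random deficiency `Y_ω(x) := 𝔻(sgn_ω, 1; x)² = ∑_{p ≤ x} (1 - sgn_ω(p))/p`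
("`∑_{p ≤ x} (1 - 𝐠'₁(p))/p`"). [cite: TaoFMP2016, proof of Proposition 2.1] -/
noncomputable def signDist (ω : Finset ℕ) (x : ℝ) : ℝ :=
  Sieve.pretentiousDistSq (fun n => (sgn ω n : ℂ)) (fun _ => 1) x

/-- `Y_ω(x)` is the pretentious distance `𝔻(sgn_ω, 1; x)²`, by definition. [folklore] -/
theorem signDist_eq_pretentiousDistSq (ω : Finset ℕ) (x : ℝ) :
    signDist ω x = Sieve.pretentiousDistSq (fun n => (sgn ω n : ℂ)) (fun _ => 1) x := rfl

/-- `Y_ω(x) = ∑_{p ≤ x} (1 - sgn_ω(p))/p`, the printed form. [cite: TaoFMP2016, proof of Proposition 2.1] -/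
theorem signDist_eq_sum (ω : Finset ℕ) (x : ℝ) :
    signDist ω x = ∑ p ∈ Nat.primesLE ⌊x⌋₊, (1 - sgn ω p) / p := by
  unfold signDist Sieve.pretentiousDistSq
  refine Finset.sum_congr rfl fun p _ => ?_
  simp

/-- `Y_ω(x) ≥ 0` (`pretentiousDistSq_nonneg`). [folklore] -/
theorem signDist_nonneg (ω : Finset ℕ) (x : ℝ) : 0 ≤ signDist ω x :=
  Sieve.pretentiousDistSq_nonneg (fun n => (norm_sgn ω n).le) (fun _ => by simp) x

/-- `𝔼 Y(x) = D(g; x)` ("By linearity of expectation we have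
`𝔼 ∑_{p ≤ x} (1 - 𝐠'₁(p))/p < A₀`"). [cite: TaoFMP2016, proof of Proposition 2.1] -/
theorem sum_wt_mul_signDist {x : ℝ} {N : ℕ} (hN : ⌊x⌋₊ ≤ N) :
    ∑ ω ∈ (Icc 1 N).powerset, wt (fun q => ‖g q‖) (Icc 1 N) ω * signDist ω x
      = modulusDist g x := by
  simp_rw [signDist_eq_sum, modulusDist_eq_sum, Finset.mul_sum]
  rw [Finset.sum_comm]
  refine Finset.sum_congr rfl fun p hp => ?_
  obtain ⟨hpx, hpp⟩ := Nat.mem_primesLE.mp hp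
  have hpU : p ∈ Icc 1 N := Finset.mem_Icc.mpr ⟨hpp.one_lt.le, hpx.trans hN⟩
  have h1 : ∀ ω : Finset ℕ, wt (fun q => ‖g q‖) (Icc 1 N) ω * ((1 - sgn ω p) / p)
      = (wt (fun q => ‖g q‖) (Icc 1 N) ω - wt (fun q => ‖g q‖) (Icc 1 N) ω * sgn ω p) / p :=
    fun ω => by ring
  simp_rw [h1]
  rw [← Finset.sum_div, Finset.sum_sub_distrib, sum_wt_eq_one, sum_wt_mul_sgn hpU]

/-- `|𝐠_ω(p) - g(p)| ≤ (1 - sgn_ω(p)) + (1 - |g(p)|)` ("By the triangle inequality we have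
`𝐠₁(p) = g₁(p) + O(1 - g'₁(p)) + O(1 - 𝐠'₁(p))`", with both implied constants equal to `1`).
[cite: TaoFMP2016, proof of Proposition 2.1] -/
theorem norm_randModel_sub_le {p : ℕ} (hp : p.Prime) (hb : ‖g p‖ ≤ 1) :
    ‖randModel g ω p - g p‖ ≤ (1 - sgn ω p) + (1 - ‖g p‖) := by
  have key : randModel g ω p - g p = ((sgn ω p - ‖g p‖ : ℝ) : ℂ) * unitC (g p) := by
    have h := norm_mul_unitC (g p)
    rw [randModel_prime g ω hp]
    calc (sgn ω p : ℂ) * unitC (g p) - g p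
        = (sgn ω p : ℂ) * unitC (g p) - (‖g p‖ : ℂ) * unitC (g p) := by rw [h]
      _ = ((sgn ω p - ‖g p‖ : ℝ) : ℂ) * unitC (g p) := by push_cast; ring
  rw [key, norm_mul, norm_unitC, mul_one, Complex.norm_real, Real.norm_eq_abs]
  have h0 := norm_nonneg (g p)
  unfold sgn
  split_ifs
  · rw [abs_of_nonpos (by linarith)]
    linarith
  · rw [abs_of_nonneg (by linarith)]
    linarith

/-- **Comparison of distances**: `𝔻(𝐠_ω, z; x)² ≥ 𝔻(g, z; x)² - Y_ω(x) - D(g; x)` for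
`1`-bounded `z` ("hence by (2.2) and the triangle inequality again we have
`∑_{p ≤ x} (1 - Re 𝐠₁(p) χ̄(p) p^{-it})/p ≥ A/2`"). [cite: TaoFMP2016, proof of Proposition 2.1] -/
theorem pretentiousDistSq_randModel_ge (hb : ∀ n, ‖g n‖ ≤ 1) {z : ℕ → ℂ}
    (hz : ∀ p, p.Prime → ‖z p‖ ≤ 1) (x : ℝ) :
    Sieve.pretentiousDistSq g z x - signDist ω x - modulusDist g x
      ≤ Sieve.pretentiousDistSq (randModel g ω) z x := by
  rw [signDist_eq_sum, modulusDist_eq_sum]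
  unfold Sieve.pretentiousDistSq
  rw [← Finset.sum_sub_distrib, ← Finset.sum_sub_distrib]
  refine Finset.sum_le_sum fun p hp => ?_
  have hp' := Nat.prime_of_mem_primesLE hp
  rw [← sub_div, ← sub_div]
  refine div_le_div_of_nonneg_right ?_ (Nat.cast_nonneg p)
  have h1 : ((randModel g ω p) * conj (z p)).re - (g p * conj (z p)).re
      ≤ ‖randModel g ω p - g p‖ := by
    rw [← Complex.sub_re, ← sub_mul]
    calc _ ≤ ‖(randModel g ω p - g p) * conj (z p)‖ := Complex.re_le_norm _
      _ = ‖randModel g ω p - g p‖ * ‖z p‖ := by rw [norm_mul, Complex.norm_conj]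
      _ ≤ ‖randModel g ω p - g p‖ * 1 := by gcongr; exact hz p hp'
      _ = _ := mul_one _
  have h2 := norm_randModel_sub_le g ω hp' (hb p)
  linarith

/-- **Hypothesis (1.5) survives the randomisation on the good event**: if `D(g; x) ≤ A₀`,
`Y_ω(x) ≤ A₀²` and `A ≥ 2(A₀² + A₀)`, then hypothesis (1.5) for `g` at level `A` gives it for
`𝐠_ω` at level `A/2`. [cite: TaoFMP2016, proof of Proposition 2.1] -/
theorem nonpretentiousAt_randModel (hb : ∀ n, ‖g n‖ ≤ 1) {A A₀ x : ℝ} (hx : 0 ≤ x)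
    (hA0 : 0 ≤ A) (hA : 2 * (A₀ ^ 2 + A₀) ≤ A) (hD : modulusDist g x ≤ A₀)
    (hY : signDist ω x ≤ A₀ ^ 2) (h : Tao2016_nonpretentiousAt g A x) :
    Tao2016_nonpretentiousAt (randModel g ω) (A / 2) x := by
  intro q χ t hq hqA htA
  have hqA' : (q : ℝ) ≤ A := hqA.trans (by linarith)
  have htA' : |t| ≤ A * x := htA.trans (by nlinarith)
  have h1 := h q χ t hq hqA' htA'
  have h2 := pretentiousDistSq_randModel_ge g ω hb (fun p _ => Sieve.norm_twistedChar_le_one χ t p) x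
  linarith

/-! ### Case 1 of Proposition 2.1: `∑_{p ≤ x} (1 - |g(p)|)/p` large

Here `|g|` has small mean value on every interval `[1, y]`, `y ≥ x^θ` (Halász's inequality
applied to the nonnegative multiplicative function `g' = |g|`), which makes the correlation
trivially small.  We record the pieces with explicit constants. -/

/-- `M(y, T) ≥ D(g; y)` for `f = |g|`: since `|g(p)| ≥ 0` and `Re p^{-it} ≤ 1`, every twisted
distance of `|g|` dominates its distance from `1`. [folklore] -/
theorem modulusDist_le_minPretentiousDistSq (y : ℝ) {T : ℝ} (hT : 0 ≤ T) :
    modulusDist g y ≤ Sieve.minPretentiousDistSq (absPart g) y T := by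
  have : Nonempty (Set.Icc (-T) T) := ⟨⟨0, by simp [hT]⟩⟩
  refine le_ciInf fun t => ?_
  rw [modulusDist_eq_sum]
  unfold Sieve.pretentiousDistSq
  refine Finset.sum_le_sum fun p hp => ?_
  have hp' := Nat.prime_of_mem_primesLE hp
  refine div_le_div_of_nonneg_right ?_ (Nat.cast_nonneg p)
  have h1 : ((absPart g p) * conj ((p : ℂ) ^ (((t : ℝ) : ℂ) * Complex.I))).re ≤ ‖g p‖ := by
    calc _ ≤ ‖(absPart g p) * conj ((p : ℂ) ^ (((t : ℝ) : ℂ) * Complex.I))‖ := Complex.re_le_norm _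
      _ = ‖g p‖ := by
          rw [norm_mul, Complex.norm_conj, norm_absPart,
            Complex.norm_natCast_cpow_of_pos hp'.pos]
          simp
  linarith

/-- `u ↦ (1 + u) e^{-u}` is non-increasing on `[0, ∞)`. [folklore] -/
theorem one_add_mul_exp_neg_le {a b : ℝ} (ha : 0 ≤ a) (hab : a ≤ b) :
    (1 + b) * Real.exp (-b) ≤ (1 + a) * Real.exp (-a) := by
  have h1 : (b - a) + 1 ≤ Real.exp (b - a) := Real.add_one_le_exp (b - a)
  have h0 : 0 ≤ Real.exp (b - a) := (Real.exp_pos _).le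
  have h2 : 1 + b ≤ (1 + a) * Real.exp (b - a) := by nlinarith
  calc (1 + b) * Real.exp (-b) ≤ (1 + a) * Real.exp (b - a) * Real.exp (-b) :=
        mul_le_mul_of_nonneg_right h2 (Real.exp_pos _).le
    _ = (1 + a) * Real.exp (-a) := by
        rw [mul_assoc, ← Real.exp_add]
        ring_nf

/-- **The mean-value input of Case 1.**  `AbsMeanValueBound C` says: for every `1`-bounded
multiplicative `g`, every `y ≥ 3` and every `0 ≤ D ≤ D(g; y) = ∑_{p ≤ y} (1 - |g(p)|)/p`,
`∑_{n ≤ y} |g(n)| ≤ C y ((2 + D) e^{-D} + 1/log y)`.  It follows from Halász's inequality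
(`absMeanValueBound_of_halasz`, with room to spare), and also from the elementary
Hall–Tenenbaum upper bound for nonnegative multiplicative functions (which is why the term
`1/log y` is allowed). [folklore] -/
def AbsMeanValueBound (C : ℝ) : Prop :=
  ∀ g : ArithmeticFunction ℂ, g.IsMultiplicative → (∀ n, ‖g n‖ ≤ 1) →
    ∀ y D : ℝ, 3 ≤ y → 0 ≤ D → D ≤ modulusDist g y →
      ∑ n ∈ Icc 1 ⌊y⌋₊, ‖g n‖ ≤ C * y * ((2 + D) * Real.exp (-D) + 1 / Real.log y)

/-- **Halász's inequality for `|g|`** (from `Literature.NumberTheory.Sieve.halaszMontgomeryTenenbaum`, taking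
`T = e^{2D}`): `∑_{n ≤ y} |g(n)| ≤ C y ((1 + D) e^{-D} + e^{-D})` for `0 ≤ D ≤ D(g; y)`, since the
twisted distances of the nonnegative function `|g|` all dominate `D(g; y)` ("Applying the Halasz
inequality … we conclude that `(1/y) ∑_{n ≤ y} g'₁(n) ≪ A₀ exp(-A₀/2)`").
[cite: TaoFMP2016, proof of Proposition 2.1] -/
theorem absMeanValueBound_of_halasz (hH : Sieve.halaszMontgomeryTenenbaum) :
    ∃ C : ℝ, 0 < C ∧ AbsMeanValueBound C := by
  obtain ⟨C₀, hC₀⟩ := hH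
  refine ⟨max C₀ 1, by positivity, fun g hg hb y D hy hD hDM => ?_⟩
  set T : ℝ := Real.exp (2 * D) with hTdef
  have hT : 1 ≤ T := Real.one_le_exp (by linarith)
  have hf := hC₀ (absPart g) (isMultiplicative_absPart hg)
    (fun n => by rw [norm_absPart]; exact hb n) y T hy hT
  have hM : D ≤ Sieve.minPretentiousDistSq (absPart g) y T :=
    hDM.trans (modulusDist_le_minPretentiousDistSq g y (by linarith))
  have hM0 : 0 ≤ Sieve.minPretentiousDistSq (absPart g) y T := hD.trans hM
  have hsum : ‖∑ n ∈ Icc 1 ⌊y⌋₊, absPart g n‖ = ∑ n ∈ Icc 1 ⌊y⌋₊, ‖g n‖ := by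
    simp only [absPart_apply]
    rw [← Complex.ofReal_sum, Complex.norm_real,
      Real.norm_of_nonneg (Finset.sum_nonneg fun n _ => norm_nonneg _)]
  have hsqrt : 1 / Real.sqrt T = Real.exp (-D) := by
    rw [hTdef, show Real.exp (2 * D) = Real.exp D * Real.exp D by rw [← Real.exp_add]; ring_nf,
      Real.sqrt_mul_self (Real.exp_pos _).le, one_div, ← Real.exp_neg]
  have hlogy : 0 ≤ 1 / Real.log y := div_nonneg zero_le_one (Real.log_nonneg (by linarith))
  rw [← hsum]
  refine hf.trans ?_
  have hbr : 0 ≤ (1 + Sieve.minPretentiousDistSq (absPart g) y T) *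
      Real.exp (-Sieve.minPretentiousDistSq (absPart g) y T) + 1 / Real.sqrt T := by positivity
  have hy0 : 0 ≤ y := by linarith
  calc C₀ * y * ((1 + Sieve.minPretentiousDistSq (absPart g) y T) *
        Real.exp (-Sieve.minPretentiousDistSq (absPart g) y T) + 1 / Real.sqrt T)
      ≤ max C₀ 1 * y * ((1 + Sieve.minPretentiousDistSq (absPart g) y T) *
        Real.exp (-Sieve.minPretentiousDistSq (absPart g) y T) + 1 / Real.sqrt T) :=
        mul_le_mul_of_nonneg_right (mul_le_mul_of_nonneg_right (le_max_left _ _) hy0) hbr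
    _ ≤ max C₀ 1 * y * ((1 + D) * Real.exp (-D) + 1 / Real.sqrt T) := by
        refine mul_le_mul_of_nonneg_left ?_ (by positivity)
        exact add_le_add_left (one_add_mul_exp_neg_le hD hM) _
    _ ≤ max C₀ 1 * y * ((2 + D) * Real.exp (-D) + 1 / Real.log y) := by
        refine mul_le_mul_of_nonneg_left ?_ (by positivity)
        rw [hsqrt]
        nlinarith [Real.exp_pos (-D)]

/-- `D(g; x) - D(g; y) ≤ ∑_{⌊y⌋ < p ≤ ⌊x⌋} 1/p` for `y ≤ x`. [folklore] -/
theorem modulusDist_sub_le {x y : ℝ} (hxy : y ≤ x) :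
    modulusDist g x - modulusDist g y
      ≤ ∑ p ∈ Ioc ⌊y⌋₊ ⌊x⌋₊, PrimeReciprocal.invPrimeWeight p := by
  have hsub : Nat.primesLE ⌊y⌋₊ ⊆ Nat.primesLE ⌊x⌋₊ := by
    intro p hp
    rw [Nat.mem_primesLE] at hp ⊢
    exact ⟨hp.1.trans (Nat.floor_le_floor hxy), hp.2⟩
  rw [modulusDist_eq_sum, modulusDist_eq_sum, ← Finset.sum_sdiff hsub, add_sub_cancel_right]
  calc ∑ p ∈ Nat.primesLE ⌊x⌋₊ \ Nat.primesLE ⌊y⌋₊, (1 - ‖g p‖) / (p : ℝ)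
      ≤ ∑ p ∈ Nat.primesLE ⌊x⌋₊ \ Nat.primesLE ⌊y⌋₊, PrimeReciprocal.invPrimeWeight p := by
        refine Finset.sum_le_sum fun p hp => ?_
        have hp' := Nat.prime_of_mem_primesLE (Finset.mem_sdiff.mp hp).1
        rw [PrimeReciprocal.invPrimeWeight_of_prime hp']
        exact div_le_div_of_nonneg_right (by linarith [norm_nonneg (g p)]) (Nat.cast_nonneg p)
    _ ≤ ∑ p ∈ Ioc ⌊y⌋₊ ⌊x⌋₊, PrimeReciprocal.invPrimeWeight p := by
        refine Finset.sum_le_sum_of_subset_of_nonneg (fun p hp => ?_)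
          fun p _ _ => PrimeReciprocal.invPrimeWeight_nonneg p
        obtain ⟨h1, h2⟩ := Finset.mem_sdiff.mp hp
        rw [Nat.mem_primesLE] at h1 h2
        rw [Finset.mem_Ioc]
        refine ⟨?_, h1.1⟩
        by_contra h
        exact h2 ⟨by omega, h1.2⟩

/-- **Mertens-type window bound (Chebyshev strength)**: for `4 ≤ y ≤ x` with
`log x ≤ K log y` (`K ≥ 1`), `D(g; x) - D(g; y) ≤ 8K + 8` ("By Mertens' theorem … this implies
that `∑_{p ≤ y} (1 - g'₁(p))/p ≥ A₀/2` for every `x^{1/A₀} ≤ y ≤ x`"; we use the dyadic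
Chebyshev bound `∑_{2^j < p ≤ 2^{j+1}} 1/p ≤ 4/j` of `PrimeReciprocalWindows`).
[cite: TaoFMP2016, proof of Proposition 2.1] -/
theorem modulusDist_window {x y K : ℝ} (hy : 4 ≤ y) (hxy : y ≤ x)
    (hK : 1 ≤ K) (hlog : Real.log x ≤ K * Real.log y) :
    modulusDist g x - modulusDist g y ≤ 8 * K + 8 := by
  set a : ℕ := Nat.log 2 ⌊y⌋₊ with ha
  set b : ℕ := Nat.log 2 ⌊x⌋₊ + 1 with hb'
  have hy4 : 4 ≤ ⌊y⌋₊ := Nat.le_floor (by exact_mod_cast hy)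
  have hyne : ⌊y⌋₊ ≠ 0 := by omega
  have hx4 : 4 ≤ ⌊x⌋₊ := Nat.le_floor (by exact_mod_cast (hy.trans hxy))
  have hxne : ⌊x⌋₊ ≠ 0 := by omega
  have ha2 : 2 ≤ a := Nat.le_log_of_pow_le one_lt_two (by simpa using hy4)
  have h2a : 2 ^ a ≤ ⌊y⌋₊ := Nat.pow_log_le_self 2 hyne
  have h2b : ⌊x⌋₊ < 2 ^ b := Nat.lt_pow_succ_log_self one_lt_two _
  have h2a' : ⌊y⌋₊ < 2 ^ (a + 1) := Nat.lt_pow_succ_log_self one_lt_two _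
  have h2b' : 2 ^ (b - 1) ≤ ⌊x⌋₊ := by
    rw [hb', Nat.add_sub_cancel]; exact Nat.pow_log_le_self 2 hxne
  have hab : a ≤ b := by
    have h3 : 2 ^ a < 2 ^ b := lt_of_le_of_lt (h2a.trans (Nat.floor_le_floor hxy)) h2b
    exact ((Nat.pow_lt_pow_iff_right (by norm_num)).mp h3).le
  -- the prime sum over the window is at most `4 (b - a) / a`
  have h1 : modulusDist g x - modulusDist g y ≤ 4 * ((b : ℝ) - a) / a := by
    refine (modulusDist_sub_le g hxy).trans ?_
    refine le_trans ?_ (PrimeReciprocal.sum_Ioc_pow_invPrimeWeight_le (by omega) hab)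
    refine Finset.sum_le_sum_of_subset_of_nonneg (fun p hp => ?_)
      fun p _ _ => PrimeReciprocal.invPrimeWeight_nonneg p
    rw [Finset.mem_Ioc] at hp ⊢
    exact ⟨lt_of_le_of_lt h2a hp.1, hp.2.trans h2b.le⟩
  -- `log y < (a + 1) log 2`, `(b - 1) log 2 ≤ log x ≤ K log y`
  have hL : 0 < Real.log 2 := Real.log_pos one_lt_two
  have hypos : 0 < y := by linarith
  have hlogy : Real.log y < (a + 1) * Real.log 2 := by
    have h3 : y < (2 : ℝ) ^ (a + 1) := by
      calc y < ⌊y⌋₊ + 1 := Nat.lt_floor_add_one y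
        _ ≤ (2 : ℝ) ^ (a + 1) := by exact_mod_cast h2a'
    have h4 := Real.log_lt_log hypos h3
    rw [Real.log_pow] at h4
    push_cast at h4
    exact h4
  have hlogx : ((b : ℝ) - 1) * Real.log 2 ≤ Real.log x := by
    have h3 : (2 : ℝ) ^ (b - 1) ≤ x := by
      calc (2 : ℝ) ^ (b - 1) ≤ ⌊x⌋₊ := by exact_mod_cast h2b'
        _ ≤ x := Nat.floor_le (by linarith)
    have h4 := Real.log_le_log (by positivity) h3
    rw [Real.log_pow, Nat.cast_sub (by omega : 1 ≤ b)] at h4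
    simpa using h4
  have ha2r : (2 : ℝ) ≤ a := by exact_mod_cast ha2
  have hba : (b : ℝ) - 1 ≤ K * (a + 1) := by
    have h4 : ((b : ℝ) - 1) * Real.log 2 ≤ (K * (a + 1)) * Real.log 2 := by
      calc ((b : ℝ) - 1) * Real.log 2 ≤ Real.log x := hlogx
        _ ≤ K * Real.log y := hlog
        _ ≤ K * ((a + 1) * Real.log 2) := mul_le_mul_of_nonneg_left hlogy.le (by linarith)
        _ = (K * (a + 1)) * Real.log 2 := by ring
    exact le_of_mul_le_mul_right h4 hL
  have ha0 : (0 : ℝ) < a := by linarith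
  refine h1.trans ?_
  rw [div_le_iff₀ ha0]
  nlinarith

/-- The number of dyadic blocks meeting `(x/ω, x]`: `log₂ ⌊x⌋ - log₂ ⌊x/ω⌋ + 1 ≤ log ω / log 2 + 2`.
[folklore] -/
theorem card_blocks_le {x ω : ℝ} (hω : 1 ≤ ω) (hωx : ω ≤ x) :
    ((Nat.log 2 ⌊x⌋₊ : ℝ) - Nat.log 2 ⌊x / ω⌋₊ + 1) ≤ Real.log ω / Real.log 2 + 2 := by
  have hL : 0 < Real.log 2 := Real.log_pos one_lt_two
  have hx1 : 1 ≤ x := hω.trans hωx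
  have hlogω : 0 ≤ Real.log ω := Real.log_nonneg hω
  have hdiv0 : 0 ≤ Real.log ω / Real.log 2 := div_nonneg hlogω hL.le
  set U := ⌊x⌋₊ with hU
  set L := ⌊x / ω⌋₊ with hLdef
  by_cases hle : Nat.log 2 U ≤ Nat.log 2 L + 1
  · have : (Nat.log 2 U : ℝ) ≤ Nat.log 2 L + 1 := by exact_mod_cast hle
    linarith
  · push Not at hle
    have hUne : U ≠ 0 := by
      have : 1 ≤ U := Nat.le_floor (by exact_mod_cast hx1); omega
    have h1 : 2 ^ Nat.log 2 U ≤ U := Nat.pow_log_le_self 2 hUne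
    have h2 : L < 2 ^ (Nat.log 2 L + 1) := Nat.lt_pow_succ_log_self one_lt_two _
    set m : ℕ := Nat.log 2 U - (Nat.log 2 L + 1) with hm
    have hmeq : Nat.log 2 U = m + (Nat.log 2 L + 1) := by omega
    have h3 : (2 : ℝ) ^ m * (2 : ℝ) ^ (Nat.log 2 L + 1) ≤ x := by
      rw [← pow_add, ← hmeq]
      calc (2 : ℝ) ^ Nat.log 2 U ≤ U := by exact_mod_cast h1
        _ ≤ x := Nat.floor_le (by linarith)
    have h4 : x / ω < (2 : ℝ) ^ (Nat.log 2 L + 1) := by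
      calc x / ω < L + 1 := Nat.lt_floor_add_one _
        _ ≤ (2 : ℝ) ^ (Nat.log 2 L + 1) := by exact_mod_cast h2
    have hxω : 0 < x / ω := div_pos (by linarith) (by linarith)
    have h5 : (2 : ℝ) ^ m < ω := by
      by_contra h6
      push Not at h6
      have h7 : ω * (x / ω) < (2 : ℝ) ^ m * (2 : ℝ) ^ (Nat.log 2 L + 1) :=
        mul_lt_mul' h6 h4 hxω.le (by positivity)
      rw [mul_div_cancel₀ _ (by linarith : ω ≠ 0)] at h7
      linarith
    have h7 : (m : ℝ) * Real.log 2 < Real.log ω := by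
      have := Real.log_lt_log (by positivity) h5
      rwa [Real.log_pow] at this
    have h8 : (m : ℝ) < Real.log ω / Real.log 2 := by rwa [lt_div_iff₀ hL]
    have h9 : (Nat.log 2 U : ℝ) = m + (Nat.log 2 L + 1) := by exact_mod_cast hmeq
    rw [h9]
    linarith

/-- **Dyadic decomposition of the large `n`.**  If `∑_{m ≤ y} |g(m)| ≤ η y` for all `y ≥ Y₀`,
then `∑_{L < n ≤ U, n ≥ Y₀} |g(an+b)|/n ≤ (log₂ U - log₂ L + 1) · η (2a + b)`: on the block
`2^j < n ≤ 2^{j+1}` one has `1/n ≤ 2^{-j}` and, dropping the congruence condition by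
nonnegativity, `∑_{n ≤ 2^{j+1}} |g(an+b)| ≤ ∑_{m ≤ a2^{j+1}+b} |g(m)| ≤ η (a 2^{j+1} + b)`
("From this and the nonnegativity and boundedness of `g'₁(n)` it is easy to see that
`∑_{x/ω ≤ n ≤ x} g'₁(a₁n+b₁)/n = o_{A₀ → ∞}(log ω)`"). [cite: TaoFMP2016, proof of Proposition 2.1] -/
theorem sum_norm_div_high_le {a b : ℕ} (ha : 1 ≤ a) {Y₀ η : ℝ} (hη : 0 ≤ η)
    (hMV : ∀ y : ℝ, Y₀ ≤ y → ∑ m ∈ Icc 1 ⌊y⌋₊, ‖g m‖ ≤ η * y) {L U : ℕ} (hLU : L ≤ U) :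
    ∑ n ∈ (Ioc L U).filter (fun n : ℕ => Y₀ ≤ (n : ℝ)), ‖g (a * n + b)‖ / (n : ℝ)
      ≤ ((Nat.log 2 U : ℝ) - Nat.log 2 L + 1) * (η * (2 * a + b)) := by
  classical
  set S := (Ioc L U).filter (fun n : ℕ => Y₀ ≤ (n : ℝ)) with hS
  set k : ℕ → ℕ := fun n => Nat.log 2 (n - 1) with hk
  have hmaps : ∀ n ∈ S, k n ∈ Icc (Nat.log 2 L) (Nat.log 2 U) := by
    intro n hn
    have hn' := Finset.mem_Ioc.mp (Finset.mem_filter.mp hn).1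
    rw [Finset.mem_Icc]
    exact ⟨Nat.log_mono_right (by omega), Nat.log_mono_right (by omega)⟩
  rw [← Finset.sum_fiberwise_of_maps_to hmaps]
  have ha0 : (0 : ℝ) < a := by exact_mod_cast ha
  have hfib : ∀ j ∈ Icc (Nat.log 2 L) (Nat.log 2 U),
      ∑ n ∈ S with k n = j, ‖g (a * n + b)‖ / (n : ℝ) ≤ η * (2 * a + b) := by
    intro j _
    have hmem : ∀ n ∈ S.filter (fun n : ℕ => k n = j),
        2 ^ j ≤ n ∧ n ≤ 2 ^ (j + 1) ∧ Y₀ ≤ (n : ℝ) ∧ 1 ≤ n := by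
      intro n hn
      obtain ⟨hnS, hkn⟩ := Finset.mem_filter.mp hn
      obtain ⟨hnI, hnY⟩ := Finset.mem_filter.mp hnS
      have hn1 : 1 ≤ n := by have := (Finset.mem_Ioc.mp hnI).1; omega
      have hkn' : Nat.log 2 (n - 1) = j := hkn
      refine ⟨?_, ?_, hnY, hn1⟩
      · rcases eq_or_ne (n - 1) 0 with h0 | h0
        · have hj : j = 0 := by rw [← hkn', h0, Nat.log_zero_right]
          subst hj
          simpa using hn1
        · have := Nat.pow_log_le_self 2 h0
          rw [hkn'] at this
          omega
      · have := Nat.lt_pow_succ_log_self one_lt_two (n - 1)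
        rw [hkn'] at this
        omega
    rcases (S.filter (fun n : ℕ => k n = j)).eq_empty_or_nonempty with hemp | ⟨n₀, hn₀⟩
    · rw [hemp, Finset.sum_empty]; positivity
    obtain ⟨-, hn₀2, hn₀Y, -⟩ := hmem n₀ hn₀
    set y : ℕ := a * 2 ^ (j + 1) + b with hy
    have hb0 : (0 : ℝ) ≤ b := Nat.cast_nonneg b
    have ha1 : (1 : ℝ) ≤ a := by exact_mod_cast ha
    have hyY : Y₀ ≤ (y : ℝ) := by
      calc Y₀ ≤ n₀ := hn₀Y
        _ ≤ (2 : ℝ) ^ (j + 1) := by exact_mod_cast hn₀2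
        _ ≤ y := by
            rw [hy]; push_cast
            have h2 : (0 : ℝ) ≤ 2 ^ (j + 1) := by positivity
            have h3 := mul_le_mul_of_nonneg_right ha1 h2
            linarith
    have hMVy := hMV y hyY
    rw [Nat.floor_natCast] at hMVy
    have h2j : (0 : ℝ) < 2 ^ j := by positivity
    calc ∑ n ∈ S with k n = j, ‖g (a * n + b)‖ / (n : ℝ)
        ≤ ∑ n ∈ S with k n = j, ((2 : ℝ) ^ j)⁻¹ * ‖g (a * n + b)‖ := by
          refine Finset.sum_le_sum fun n hn => ?_
          obtain ⟨hn2, -, -, hn1⟩ := hmem n hn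
          rw [div_eq_inv_mul]
          refine mul_le_mul_of_nonneg_right ?_ (norm_nonneg _)
          exact inv_anti₀ h2j (by exact_mod_cast hn2)
      _ = ((2 : ℝ) ^ j)⁻¹ * ∑ n ∈ S with k n = j, ‖g (a * n + b)‖ := by rw [Finset.mul_sum]
      _ ≤ ((2 : ℝ) ^ j)⁻¹ * ∑ n ∈ Icc 1 (2 ^ (j + 1)), ‖g (a * n + b)‖ := by
          refine mul_le_mul_of_nonneg_left ?_ (by positivity)
          refine Finset.sum_le_sum_of_subset_of_nonneg (fun n hn => ?_) fun _ _ _ => norm_nonneg _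
          obtain ⟨-, hn2, -, hn1⟩ := hmem n hn
          exact Finset.mem_Icc.mpr ⟨hn1, hn2⟩
      _ ≤ ((2 : ℝ) ^ j)⁻¹ * ∑ m ∈ Icc 1 y, ‖g m‖ := by
          refine mul_le_mul_of_nonneg_left ?_ (by positivity)
          have hinj : Set.InjOn (fun n => a * n + b) (Icc 1 (2 ^ (j + 1)) : Finset ℕ) := by
            intro n _ n' _ h
            have h' : a * n = a * n' := by simpa using h
            exact Nat.eq_of_mul_eq_mul_left (by omega) h'
          rw [← Finset.sum_image (f := fun m => ‖g m‖) hinj]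
          refine Finset.sum_le_sum_of_subset_of_nonneg (fun m hm => ?_) fun _ _ _ => norm_nonneg _
          obtain ⟨n, hn, rfl⟩ := Finset.mem_image.mp hm
          rw [Finset.mem_Icc] at hn
          rw [Finset.mem_Icc, hy]
          constructor
          · nlinarith
          · nlinarith
      _ ≤ ((2 : ℝ) ^ j)⁻¹ * (η * y) := mul_le_mul_of_nonneg_left hMVy (by positivity)
      _ ≤ η * (2 * a + b) := by
          rw [hy]
          push_cast
          rw [inv_mul_le_iff₀ h2j]
          have h1 : (1 : ℝ) ≤ 2 ^ j := one_le_pow₀ (by norm_num)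
          have h3 : (2 : ℝ) ^ (j + 1) = 2 * 2 ^ j := by ring
          rw [h3]
          nlinarith [mul_nonneg hη hb0]
  calc ∑ j ∈ Icc (Nat.log 2 L) (Nat.log 2 U), ∑ n ∈ S with k n = j, ‖g (a * n + b)‖ / (n : ℝ)
      ≤ ∑ j ∈ Icc (Nat.log 2 L) (Nat.log 2 U), η * (2 * a + b) := Finset.sum_le_sum hfib
    _ = (#(Icc (Nat.log 2 L) (Nat.log 2 U)) : ℝ) * (η * (2 * a + b)) := by
        rw [Finset.sum_const, nsmul_eq_mul]
    _ ≤ ((Nat.log 2 U : ℝ) - Nat.log 2 L + 1) * (η * (2 * a + b)) := by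
        refine mul_le_mul_of_nonneg_right ?_ (by positivity)
        have hLU' : Nat.log 2 L ≤ Nat.log 2 U := Nat.log_mono_right hLU
        rw [Nat.card_Icc, Nat.cast_sub (by omega)]
        push_cast
        linarith

/-- **The small `n`.**  With `Y₀ = max (8, x^θ)`, `0 < θ ≤ 1/2` and `1 ≤ ω ≤ x`:
`∑_{x/ω < n ≤ x, n < Y₀} 1/n ≤ 6 + 2θ log ω` (the terms only exist when `x/ω < Y₀`, in which
case `log x ≤ 2 log 8 + 2 log ω`). [folklore] -/
theorem sum_inv_low_le {x ω θ : ℝ} (hω : 1 ≤ ω) (hωx : ω ≤ x) (hθ : 0 < θ) (hθ2 : θ ≤ 1 / 2) :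
    ∑ n ∈ (Ioc ⌊x / ω⌋₊ ⌊x⌋₊).filter (fun n : ℕ => ¬ (max 8 (x ^ θ) ≤ (n : ℝ))), (n : ℝ)⁻¹
      ≤ 6 + 2 * θ * Real.log ω := by
  set Y₀ := max 8 (x ^ θ) with hY
  have hx1 : 1 ≤ x := hω.trans hωx
  have hxpos : 0 < x := by linarith
  have hωpos : 0 < ω := by linarith
  have hlogω : 0 ≤ Real.log ω := Real.log_nonneg hω
  have hxθ : 1 ≤ x ^ θ := Real.one_le_rpow hx1 hθ.le
  have hxθpos : 0 < x ^ θ := by linarith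
  have hY8 : Y₀ ≤ 8 * x ^ θ := max_le (by nlinarith) (by nlinarith)
  have hY1 : 8 ≤ Y₀ := le_max_left _ _
  have hlog8 : Real.log 8 ≤ 21 / 10 := by
    rw [show (8 : ℝ) = 2 ^ 3 by norm_num, Real.log_pow]
    have := Real.log_two_lt_d9
    push_cast
    linarith
  by_cases hcase : x / ω ≤ Y₀
  · have hsub : (Ioc ⌊x / ω⌋₊ ⌊x⌋₊).filter (fun n : ℕ => ¬ (Y₀ ≤ (n : ℝ))) ⊆ Ioc ⌊x / ω⌋₊ ⌊Y₀⌋₊ := by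
      intro n hn
      obtain ⟨hn1, hn2⟩ := Finset.mem_filter.mp hn
      rw [Finset.mem_Ioc] at hn1 ⊢
      exact ⟨hn1.1, Nat.le_floor (le_of_lt (not_le.mp hn2))⟩
    have hxω : 0 < x / ω := div_pos hxpos hωpos
    have h1 : Real.log x - Real.log ω ≤ Real.log 8 + θ * Real.log x := by
      have := Real.log_le_log hxω (hcase.trans hY8)
      rwa [Real.log_div hxpos.ne' hωpos.ne', Real.log_mul (by norm_num) hxθpos.ne',
        Real.log_rpow hxpos] at this
    have hlogY : Real.log Y₀ ≤ Real.log 8 + θ * Real.log x := by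
      calc Real.log Y₀ ≤ Real.log (8 * x ^ θ) := Real.log_le_log (by linarith) hY8
        _ = Real.log 8 + θ * Real.log x := by
            rw [Real.log_mul (by norm_num) hxθpos.ne', Real.log_rpow hxpos]
    have hlogx0 : 0 ≤ Real.log x := Real.log_nonneg hx1
    have hlogωx : Real.log ω ≤ Real.log x := Real.log_le_log hωpos hωx
    have hθx : 0 ≤ (1 / 2 - θ) * Real.log x := mul_nonneg (by linarith) hlogx0
    have h2 : Real.log x ≤ 2 * Real.log 8 + 2 * Real.log ω := by nlinarith
    have h3 : θ * Real.log x ≤ θ * (2 * Real.log 8 + 2 * Real.log ω) :=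
      mul_le_mul_of_nonneg_left h2 hθ.le
    have h3' : θ * Real.log x ≤ 2 * (θ * Real.log 8) + 2 * θ * Real.log ω := by linarith [h3.trans_eq (by ring : θ * (2 * Real.log 8 + 2 * Real.log ω) = 2 * (θ * Real.log 8) + 2 * θ * Real.log ω)]
    have h4 : θ * Real.log 8 ≤ 1 / 2 * Real.log 8 :=
      mul_le_mul_of_nonneg_right hθ2 (by linarith [Real.log_nonneg (by norm_num : (1:ℝ) ≤ 8)])
    calc ∑ n ∈ (Ioc ⌊x / ω⌋₊ ⌊x⌋₊).filter (fun n : ℕ => ¬ (Y₀ ≤ (n : ℝ))), (n : ℝ)⁻¹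
        ≤ ∑ n ∈ Ioc ⌊x / ω⌋₊ ⌊Y₀⌋₊, (n : ℝ)⁻¹ :=
          Finset.sum_le_sum_of_subset_of_nonneg hsub fun _ _ _ => by positivity
      _ ≤ 1 + Real.log (Y₀ / (x / ω)) := sum_inv_Ioc_floor_le hxω hcase
      _ = 1 + Real.log Y₀ + Real.log ω - Real.log x := by
          rw [Real.log_div (by linarith) hxω.ne', Real.log_div hxpos.ne' hωpos.ne']; ring
      _ ≤ 6 + 2 * θ * Real.log ω := by linarith
  · have hemp : (Ioc ⌊x / ω⌋₊ ⌊x⌋₊).filter (fun n : ℕ => ¬ (Y₀ ≤ (n : ℝ))) = ∅ := by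
      refine Finset.eq_empty_of_forall_notMem fun n hn => ?_
      obtain ⟨hn1, hn2⟩ := Finset.mem_filter.mp hn
      have h1 : ⌊x / ω⌋₊ + 1 ≤ n := Nat.lt_iff_add_one_le.mp (Finset.mem_Ioc.mp hn1).1
      have h2 : x / ω < n := by
        calc x / ω < (⌊x / ω⌋₊ : ℝ) + 1 := Nat.lt_floor_add_one _
          _ = ((⌊x / ω⌋₊ + 1 : ℕ) : ℝ) := by push_cast; ring
          _ ≤ n := by exact_mod_cast h1
      exact hn2 (by linarith [not_le.mp hcase])
    rw [hemp, Finset.sum_empty]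
    positivity

/-- `|corr| ≤ ∑ |g₁(a₁n+b₁)|/n` when `|g₂| ≤ 1` ("Since `g₁(a₁n+b₁) g₂(a₂n+b₂)` is bounded in
magnitude by `g'₁(a₁n+b₁)`"). [cite: TaoFMP2016, proof of Proposition 2.1] -/
theorem norm_logCorrelation_le_sum_norm (g₁ g₂ : ℕ → ℂ) (hb₂ : ∀ n, ‖g₂ n‖ ≤ 1)
    (a₁ b₁ a₂ b₂ : ℕ) (x ω : ℝ) :
    ‖logCorrelation g₁ g₂ a₁ b₁ a₂ b₂ x ω‖
      ≤ ∑ n ∈ Ioc ⌊x / ω⌋₊ ⌊x⌋₊, ‖g₁ (a₁ * n + b₁)‖ / (n : ℝ) := by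
  unfold logCorrelation
  refine (norm_sum_le _ _).trans (Finset.sum_le_sum fun n _ => ?_)
  rw [norm_div, norm_mul, Complex.norm_natCast]
  refine div_le_div_of_nonneg_right ?_ (Nat.cast_nonneg n)
  calc ‖g₁ (a₁ * n + b₁)‖ * ‖g₂ (a₂ * n + b₂)‖ ≤ ‖g₁ (a₁ * n + b₁)‖ * 1 := by
        gcongr; exact hb₂ _
    _ = _ := mul_one _

/-- The trivial bound `|corr| ≤ ∑_{x/ω < n ≤ x} 1/n ≤ 1 + log ω` for `1`-bounded `g₁, g₂` and
`1 ≤ ω ≤ x` ("we can still bound the left-hand side of (2.3) by `O(log ω)`").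
[cite: TaoFMP2016, proof of Proposition 2.1] -/
theorem norm_logCorrelation_le_log (g₁ g₂ : ℕ → ℂ) (hb₁ : ∀ n, ‖g₁ n‖ ≤ 1)
    (hb₂ : ∀ n, ‖g₂ n‖ ≤ 1) (a₁ b₁ a₂ b₂ : ℕ) {x ω : ℝ} (hω : 1 ≤ ω) (hωx : ω ≤ x) :
    ‖logCorrelation g₁ g₂ a₁ b₁ a₂ b₂ x ω‖ ≤ 1 + Real.log ω := by
  have hxpos : 0 < x := by linarith
  have hxω : 0 < x / ω := div_pos hxpos (by linarith)
  refine (norm_logCorrelation_le_sum_norm g₁ g₂ hb₂ a₁ b₁ a₂ b₂ x ω).trans ?_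
  calc ∑ n ∈ Ioc ⌊x / ω⌋₊ ⌊x⌋₊, ‖g₁ (a₁ * n + b₁)‖ / (n : ℝ)
      ≤ ∑ n ∈ Ioc ⌊x / ω⌋₊ ⌊x⌋₊, (n : ℝ)⁻¹ := by
        refine Finset.sum_le_sum fun n _ => ?_
        rw [← one_div]
        exact div_le_div_of_nonneg_right (hb₁ _) (Nat.cast_nonneg n)
    _ ≤ 1 + Real.log (x / (x / ω)) := sum_inv_Ioc_floor_le hxω (div_le_self hxpos.le hω)
    _ = 1 + Real.log ω := by rw [div_div_cancel₀ hxpos.ne']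

/-- **Case 1 of the proof of Proposition 2.1, quantified.**  If `∑_{p ≤ x} (1 - |g(p)|)/p ≥ A₀`
with `A₀ ≥ 512/ε₀ + 16` and `A₀ ≥ 512 C (2a+b)/ε₀` (`C` the constant of the mean value bound for
`|g|`), then for `max(exp(112/ε₀), exp(2048 C (2a+b)/ε₀²)) ≤ ω ≤ x`:
`∑_{x/ω < n ≤ x} |g(an+b)|/n ≤ (ε₀/4) log ω`.  (Parameters: `θ = ε₀/32`, `Y₀ = max(8, x^θ)`;
the deficiency stays `≥ A₀/2` on `[Y₀, ∞)` by the window bound, the mean value bound gives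
`∑_{m ≤ y} |g(m)| ≤ (8C/A₀ + C/(θ log x)) y` there, the large `n` are handled dyadically and the
small `n` trivially.) [cite: TaoFMP2016, proof of Proposition 2.1] -/
theorem case1_bound (hb1 : ∀ n, ‖g n‖ ≤ 1) {a b : ℕ} (ha : 1 ≤ a)
    {ε₀ C A₀ x ω : ℝ} (hε₀ : 0 < ε₀) (hε₁ : ε₀ ≤ 1) (hC : 0 < C)
    (hMV : ∀ y D : ℝ, 3 ≤ y → 0 ≤ D → D ≤ modulusDist g y →
        ∑ n ∈ Icc 1 ⌊y⌋₊, ‖g n‖ ≤ C * y * ((2 + D) * Real.exp (-D) + 1 / Real.log y))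
    (hA₀K : 512 / ε₀ + 16 ≤ A₀) (hA₀C : 512 * C * (2 * a + b) / ε₀ ≤ A₀)
    (hω : Real.exp (112 / ε₀) ≤ ω) (hω' : Real.exp (2048 * C * (2 * a + b) / ε₀ ^ 2) ≤ ω)
    (hωx : ω ≤ x) (hD : A₀ ≤ modulusDist g x) :
    ∑ n ∈ Ioc ⌊x / ω⌋₊ ⌊x⌋₊, ‖g (a * n + b)‖ / (n : ℝ) ≤ ε₀ / 4 * Real.log ω := by
  -- parameters
  set θ : ℝ := ε₀ / 32 with hθ
  set K : ℝ := 32 / ε₀ with hK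
  set Y₀ : ℝ := max 8 (x ^ θ) with hY₀
  have hθpos : 0 < θ := by positivity
  have hθ2 : θ ≤ 1 / 2 := by rw [hθ]; linarith
  have hK1 : 1 ≤ K := by rw [hK, le_div_iff₀ hε₀]; linarith
  have hKθ : K * θ = 1 := by rw [hK, hθ]; field_simp
  have h512 : 512 ≤ 512 / ε₀ := by rw [le_div_iff₀ hε₀]; linarith
  have hA₀4 : 4 ≤ A₀ := by linarith
  have hA₀pos : 0 < A₀ := by linarith
  have hω1 : 1 ≤ ω := le_trans (Real.one_le_exp (by positivity)) hω
  have hωpos : 0 < ω := by linarith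
  have hx1 : 1 ≤ x := hω1.trans hωx
  have hxpos : 0 < x := by linarith
  have hlogω : 112 / ε₀ ≤ Real.log ω := by
    rw [← Real.log_exp (112 / ε₀)]
    exact Real.log_le_log (Real.exp_pos _) hω
  have hlogω0 : 0 ≤ Real.log ω := Real.log_nonneg hω1
  have hab0 : (0 : ℝ) ≤ 2 * a + b := by positivity
  -- Step 1: the deficiency stays `≥ A₀/2` on `[Y₀, ∞)`
  have hdef : ∀ y, Y₀ ≤ y → A₀ / 2 ≤ modulusDist g y := by
    intro y hy
    rcases le_or_gt x y with hxy | hxy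
    · linarith [hD.trans (modulusDist_mono hb1 hxy)]
    · have hy8 : 8 ≤ y := (le_max_left _ _).trans hy
      have hypos : 0 < y := by linarith
      have hyθ : x ^ θ ≤ y := (le_max_right _ _).trans hy
      have hlog : Real.log x ≤ K * Real.log y := by
        have h1 : θ * Real.log x ≤ Real.log y := by
          rw [← Real.log_rpow hxpos]
          exact Real.log_le_log (Real.rpow_pos_of_pos hxpos θ) hyθ
        calc Real.log x = K * (θ * Real.log x) := by rw [← mul_assoc, hKθ, one_mul]
          _ ≤ K * Real.log y := mul_le_mul_of_nonneg_left h1 (by linarith)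
      have hw := modulusDist_window g (by linarith) hxy.le hK1 hlog
      have h16 : 8 * K + 8 ≤ A₀ / 2 := by
        rw [hK]
        have : 8 * (32 / ε₀) = 256 / ε₀ := by ring
        have h2 : 512 / ε₀ = 2 * (256 / ε₀) := by ring
        linarith
      linarith
  -- Step 2: the mean value bound on `[Y₀, ∞)` with `D = A₀/2`; there `1/log y ≤ 1/(θ log x)`
  have hlogx : 2048 * C * (2 * a + b) / ε₀ ^ 2 ≤ Real.log x := by
    rw [← Real.log_exp (2048 * C * (2 * a + b) / ε₀ ^ 2)]
    exact Real.log_le_log (Real.exp_pos _) (hω'.trans hωx)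
  have hlogx112 : 112 ≤ Real.log x := by
    have h1 : 112 ≤ 112 / ε₀ := by rw [le_div_iff₀ hε₀]; linarith
    linarith [Real.log_le_log hωpos hωx]
  have hlogxpos : 0 < Real.log x := by linarith
  set η : ℝ := C * ((2 + A₀ / 2) * Real.exp (-(A₀ / 2)) + 1 / (θ * Real.log x)) with hη
  have hη0 : 0 ≤ η := by positivity
  have hMV' : ∀ y, Y₀ ≤ y → ∑ m ∈ Icc 1 ⌊y⌋₊, ‖g m‖ ≤ η * y := by
    intro y hy
    have hy3 : 3 ≤ y := by linarith [le_max_left 8 (x ^ θ)]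
    have hypos : 0 < y := by linarith
    have h := hMV y (A₀ / 2) hy3 (by linarith) (hdef y hy)
    have hyθ : x ^ θ ≤ y := (le_max_right _ _).trans hy
    have hlogy : θ * Real.log x ≤ Real.log y := by
      rw [← Real.log_rpow hxpos]
      exact Real.log_le_log (Real.rpow_pos_of_pos hxpos θ) hyθ
    have hθlog : 0 < θ * Real.log x := mul_pos hθpos hlogxpos
    have h1 : 1 / Real.log y ≤ 1 / (θ * Real.log x) :=
      one_div_le_one_div_of_le hθlog hlogy
    calc _ ≤ _ := h
      _ ≤ C * y * ((2 + A₀ / 2) * Real.exp (-(A₀ / 2)) + 1 / (θ * Real.log x)) := by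
          refine mul_le_mul_of_nonneg_left (by linarith) (by positivity)
      _ = η * y := by rw [hη]; ring
  have hηA : η ≤ 8 * C / A₀ + C / (θ * Real.log x) := by
    have hu : 0 < A₀ / 2 := by linarith
    have hexp : 1 + A₀ / 2 + (A₀ / 2) ^ 2 / 2 ≤ Real.exp (A₀ / 2) :=
      Real.quadratic_le_exp_of_nonneg hu.le
    have hepos : 0 < Real.exp (A₀ / 2) := Real.exp_pos _
    have h1 : (2 + A₀ / 2) * Real.exp (-(A₀ / 2)) ≤ 4 / (A₀ / 2) := by
      have e1 : (2 + A₀ / 2) * Real.exp (-(A₀ / 2)) = (2 + A₀ / 2) / Real.exp (A₀ / 2) := by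
        rw [Real.exp_neg]; ring
      rw [e1, div_le_div_iff₀ hepos hu]
      have hsq : 0 ≤ (A₀ / 2) ^ 2 := sq_nonneg _
      linarith
    calc η = C * ((2 + A₀ / 2) * Real.exp (-(A₀ / 2))) + C / (θ * Real.log x) := by
          rw [hη]; ring
      _ ≤ C * (4 / (A₀ / 2)) + C / (θ * Real.log x) := by
          gcongr
      _ = 8 * C / A₀ + C / (θ * Real.log x) := by field_simp; ring
  have hηab : η * (2 * a + b) ≤ ε₀ / 32 := by
    have h1 : 8 * C / A₀ * (2 * a + b) ≤ ε₀ / 64 := by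
      calc 8 * C / A₀ * (2 * a + b) = (512 * C * (2 * a + b) / ε₀) * (ε₀ / 64) / A₀ := by
            field_simp; ring
        _ ≤ A₀ * (ε₀ / 64) / A₀ := by gcongr
        _ = ε₀ / 64 := by field_simp
    have h2 : C / (θ * Real.log x) * (2 * a + b) ≤ ε₀ / 64 := by
      rw [hθ]
      calc C / (ε₀ / 32 * Real.log x) * (2 * a + b)
          = (2048 * C * (2 * a + b) / ε₀ ^ 2) * (ε₀ / 64) / Real.log x := by
            field_simp; ring
        _ ≤ Real.log x * (ε₀ / 64) / Real.log x := by gcongr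
        _ = ε₀ / 64 := by field_simp
    calc η * (2 * a + b) ≤ (8 * C / A₀ + C / (θ * Real.log x)) * (2 * a + b) :=
          mul_le_mul_of_nonneg_right hηA hab0
      _ = 8 * C / A₀ * (2 * a + b) + C / (θ * Real.log x) * (2 * a + b) := by ring
      _ ≤ ε₀ / 64 + ε₀ / 64 := add_le_add h1 h2
      _ = ε₀ / 32 := by ring
  -- Step 3: split the range at `Y₀`
  rw [← Finset.sum_filter_add_sum_filter_not _ (fun n : ℕ => Y₀ ≤ (n : ℝ))]
  have hLU : ⌊x / ω⌋₊ ≤ ⌊x⌋₊ := Nat.floor_le_floor (div_le_self hxpos.le hω1)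
  have hhigh := sum_norm_div_high_le g ha hη0 hMV' hLU (b := b)
  have hblocks := card_blocks_le hω1 hωx
  have hlow := sum_inv_low_le hω1 hωx hθpos hθ2
  have hlow' : ∑ n ∈ (Ioc ⌊x / ω⌋₊ ⌊x⌋₊).filter (fun n : ℕ => ¬ (Y₀ ≤ (n : ℝ))),
      ‖g (a * n + b)‖ / (n : ℝ) ≤ 6 + 2 * θ * Real.log ω := by
    refine le_trans (Finset.sum_le_sum fun n _ => ?_) hlow
    rw [← one_div]
    exact div_le_div_of_nonneg_right (hb1 _) (Nat.cast_nonneg n)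
  -- Step 4: arithmetic
  have hL2 : (1 : ℝ) / 2 ≤ Real.log 2 := by
    have := Real.log_two_gt_d9; linarith
  have hdiv : Real.log ω / Real.log 2 ≤ 2 * Real.log ω := by
    rw [div_le_iff₀ (by linarith)]; nlinarith
  have hhigh' : ∑ n ∈ (Ioc ⌊x / ω⌋₊ ⌊x⌋₊).filter (fun n : ℕ => Y₀ ≤ (n : ℝ)),
      ‖g (a * n + b)‖ / (n : ℝ) ≤ (2 * Real.log ω + 2) * (ε₀ / 32) := by
    refine hhigh.trans ?_
    calc ((Nat.log 2 ⌊x⌋₊ : ℝ) - Nat.log 2 ⌊x / ω⌋₊ + 1) * (η * (2 * a + b))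
        ≤ (Real.log ω / Real.log 2 + 2) * (η * (2 * a + b)) :=
          mul_le_mul_of_nonneg_right hblocks (mul_nonneg hη0 hab0)
      _ ≤ (2 * Real.log ω + 2) * (ε₀ / 32) :=
          mul_le_mul (by linarith) hηab (mul_nonneg hη0 hab0) (by linarith)
  have h7 : 7 ≤ ε₀ / 16 * Real.log ω := by
    have e7 : ε₀ / 16 * (112 / ε₀) = 7 := by field_simp; ring
    have := mul_le_mul_of_nonneg_left hlogω (by positivity : (0 : ℝ) ≤ ε₀ / 16)
    linarith
  have hlow'' : ∑ n ∈ (Ioc ⌊x / ω⌋₊ ⌊x⌋₊).filter (fun n : ℕ => ¬ (Y₀ ≤ (n : ℝ))),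
      ‖g (a * n + b)‖ / (n : ℝ) ≤ 6 + ε₀ / 16 * Real.log ω := by
    have e : 2 * θ * Real.log ω = ε₀ / 16 * Real.log ω := by rw [hθ]; ring
    linarith
  have hεlog : 0 ≤ ε₀ * Real.log ω := mul_nonneg hε₀.le hlogω0
  linarith

end Tao2016

open Tao2016

/-! ## The `g₂`-analogue of Proposition 2.1, proved

Randomising the second factor does not touch hypothesis (1.5), so no case distinction is needed:
`g₂` is the mean of the unimodular multiplicative `𝐠₂ = 𝐠'₂ g''₂`, the correlation is linear in
`g₂`, and the hypothesis applies to every realisation of `𝐠₂`. -/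

/-- **Engine for the `g₂`-slot**: Theorem 1.3 for (`g₁ ∈ P₁`, `g₂` unimodular) implies
Theorem 1.3 for (`g₁ ∈ P₁`, `g₂` arbitrary `1`-bounded multiplicative), by averaging over the
random unimodular model of `g₂` ("A similar argument allows one to also reduce to the case where
`|g₂(n)| = 1` for all `n` (indeed, the argument is slightly simpler as (2.2) is unaffected by changes
in `g₂`)"). [cite: TaoFMP2016, §2 (paragraph after the proof of Proposition 2.1)] -/
theorem Tao2016_theorem13For.of_circleValued_right {P₁ : ArithmeticFunction ℂ → Prop}
    (h : Tao2016_theorem13For P₁ IsCircleValued) : Tao2016_theorem13For P₁ (fun _ => True) := by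
  intro a₁ a₂ b₁ b₂ ha₁ ha₂ hab ε hε
  obtain ⟨A₁, hA₁⟩ := h a₁ a₂ b₁ b₂ ha₁ ha₂ hab ε hε
  refine ⟨A₁, fun A hA x ω hAω hωx g₁ g₂ hg₁ hg₂ hb₁ hb₂ hP₁ _ hhyp => ?_⟩
  have hθ₁ : ∀ q, ‖g₂ q‖ ≤ 1 := hb₂
  have hθ₂ : ∀ q, -1 ≤ ‖g₂ q‖ := fun q => by linarith [norm_nonneg (g₂ q)]
  rw [← sum_wt_mul_logCorrelation_right g₂ hg₂ g₁ a₁ b₁ ha₂ b₂ x ω le_rfl]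
  refine (norm_sum_wt_mul_le hθ₁ hθ₂ _ _).trans ?_
  calc ∑ ω' ∈ (Icc 1 (a₂ * ⌊x⌋₊ + b₂)).powerset,
        wt (fun q => ‖g₂ q‖) (Icc 1 (a₂ * ⌊x⌋₊ + b₂)) ω' *
          ‖logCorrelation g₁ (randModel g₂ ω') a₁ b₁ a₂ b₂ x ω‖
      ≤ ∑ ω' ∈ (Icc 1 (a₂ * ⌊x⌋₊ + b₂)).powerset,
          wt (fun q => ‖g₂ q‖) (Icc 1 (a₂ * ⌊x⌋₊ + b₂)) ω' * (ε * Real.log ω) := by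
        refine Finset.sum_le_sum fun ω' _ => mul_le_mul_of_nonneg_left ?_ (wt_nonneg hθ₁ hθ₂ _ _)
        exact hA₁ A hA x ω hAω hωx g₁ (randModel g₂ ω') hg₁ (isMultiplicative_randModel g₂ ω')
          hb₁ (norm_randModel_le_one g₂ ω') hP₁ (isCircleValued_randModel g₂ ω') hhyp
    _ = ε * Real.log ω := by
        rw [← Finset.sum_mul, sum_wt_eq_one, one_mul]

/-! ## Proposition 2.1, proved from Halász's inequality

The first factor carries hypothesis (1.5), which survives the randomisation only on the event
`Y_ω(x) < A₀²`; this has probability `1 - O(1/A₀)` (Markov) provided `D(g₁; x) < A₀` (Case 2),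
and the complementary Case 1 (`D(g₁; x) ≥ A₀`) is settled by Halász's inequality for `|g₁|`. -/

/-- **Engine for the `g₁`-slot** (the proof of Proposition 2.1, for an arbitrary class `P₂` of
second factors): assuming the mean value bound `AbsMeanValueBound C` for moduli of
multiplicative functions (a consequence of Halász's inequality, `absMeanValueBound_of_halasz`),
Theorem 1.3 for (`g₁` unimodular, `g₂ ∈ P₂`) implies Theorem 1.3 for (`g₁` arbitrary,
`g₂ ∈ P₂`).  Constants: `ε₀ = min(ε, 1)`; `A₀ = max(512/ε₀ + 16, 512 C (2a₁+b₁)/ε₀)`;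
`A ≥ max(2A₁, 2(A₀² + A₀), exp(112/ε₀), exp(2048 C (2a₁+b₁)/ε₀²))` where `A₁` is the threshold
of the unimodular case with `ε₀/2` and `C` the constant of the mean value bound for `|g₁|`.
[cite: TaoFMP2016, Proposition 2.1 (proof)] -/
theorem Tao2016_theorem13For.of_circleValued_left_of_mv {C : ℝ} (hC : 0 < C)
    (hMV : AbsMeanValueBound C)
    {P₂ : ArithmeticFunction ℂ → Prop} (h : Tao2016_theorem13For IsCircleValued P₂) :
    Tao2016_theorem13For (fun _ => True) P₂ := by
  intro a₁ a₂ b₁ b₂ ha₁ ha₂ hab ε hε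
  set ε₀ : ℝ := min ε 1 with hε₀
  have hε₀pos : 0 < ε₀ := lt_min hε one_pos
  have hε₀1 : ε₀ ≤ 1 := min_le_right _ _
  have hε₀ε : ε₀ ≤ ε := min_le_left _ _
  obtain ⟨A₁, hA₁⟩ := h a₁ a₂ b₁ b₂ ha₁ ha₂ hab (ε₀ / 2) (half_pos hε₀pos)
  set A₀ : ℝ := max (512 / ε₀ + 16) (512 * C * (2 * a₁ + b₁) / ε₀) with hA₀
  have hA₀K : 512 / ε₀ + 16 ≤ A₀ := le_max_left _ _
  have hA₀C : 512 * C * (2 * a₁ + b₁) / ε₀ ≤ A₀ := le_max_right _ _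
  have h8 : 8 / ε₀ ≤ A₀ := by
    have : 8 / ε₀ ≤ 512 / ε₀ := div_le_div_of_nonneg_right (by norm_num) hε₀pos.le
    linarith
  have hA₀pos : 0 < A₀ := lt_of_lt_of_le (by positivity) h8
  refine ⟨max (max (2 * A₁) (2 * (A₀ ^ 2 + A₀)))
    (max (Real.exp (112 / ε₀)) (Real.exp (2048 * C * (2 * a₁ + b₁) / ε₀ ^ 2))), ?_⟩
  intro A hA x ω hAω hωx g₁ g₂ hg₁ hg₂ hb₁ hb₂ _ hP₂ hhyp
  have hAexp : Real.exp (112 / ε₀) ≤ A := ((le_max_left _ _).trans (le_max_right _ _)).trans hA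
  have hAexp' : Real.exp (2048 * C * (2 * a₁ + b₁) / ε₀ ^ 2) ≤ A :=
    ((le_max_right _ _).trans (le_max_right _ _)).trans hA
  have hA2A₁ : 2 * A₁ ≤ A := ((le_max_left _ _).trans (le_max_left _ _)).trans hA
  have hA2A₀ : 2 * (A₀ ^ 2 + A₀) ≤ A := ((le_max_right _ _).trans (le_max_left _ _)).trans hA
  have hA1 : 1 ≤ A := le_trans (Real.one_le_exp (by positivity)) hAexp
  have hApos : 0 < A := by linarith
  have hω1 : 1 ≤ ω := hA1.trans hAω
  have hxpos : 0 < x := by linarith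
  have hlogω : 112 / ε₀ ≤ Real.log ω := by
    rw [← Real.log_exp (112 / ε₀)]
    exact Real.log_le_log (Real.exp_pos _) (hAexp.trans hAω)
  have h112 : 112 ≤ 112 / ε₀ := by rw [le_div_iff₀ hε₀pos]; linarith
  have hlogω1 : 1 ≤ Real.log ω := by linarith
  have hlogω0 : 0 ≤ Real.log ω := by linarith
  have hεlog : ε₀ * Real.log ω ≤ ε * Real.log ω := mul_le_mul_of_nonneg_right hε₀ε hlogω0
  have hεlog0 : 0 ≤ ε₀ * Real.log ω := mul_nonneg hε₀pos.le hlogω0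
  by_cases hcase : A₀ ≤ modulusDist g₁ x
  · -- Case 1: `∑_{p ≤ x} (1 - |g₁(p)|)/p ≥ A₀`
    calc ‖logCorrelation g₁ g₂ a₁ b₁ a₂ b₂ x ω‖
        ≤ ∑ n ∈ Ioc ⌊x / ω⌋₊ ⌊x⌋₊, ‖g₁ (a₁ * n + b₁)‖ / (n : ℝ) :=
          norm_logCorrelation_le_sum_norm g₁ g₂ hb₂ a₁ b₁ a₂ b₂ x ω
      _ ≤ ε₀ / 4 * Real.log ω :=
          case1_bound g₁ hb₁ ha₁ hε₀pos hε₀1 hC (hMV g₁ hg₁ hb₁) hA₀K hA₀C (hAexp.trans hAω)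
            (hAexp'.trans hAω) hωx hcase
      _ ≤ ε * Real.log ω := by linarith
  · -- Case 2: `∑_{p ≤ x} (1 - |g₁(p)|)/p < A₀`: average over the random model of `g₁`
    have hD : modulusDist g₁ x ≤ A₀ := (not_le.mp hcase).le
    have hNx : ⌊x⌋₊ ≤ a₁ * ⌊x⌋₊ + b₁ := by
      calc ⌊x⌋₊ = 1 * ⌊x⌋₊ := (one_mul _).symm
        _ ≤ a₁ * ⌊x⌋₊ := Nat.mul_le_mul_right _ ha₁
        _ ≤ a₁ * ⌊x⌋₊ + b₁ := Nat.le_add_right _ _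
    have hθ₁ : ∀ q, ‖g₁ q‖ ≤ 1 := hb₁
    have hθ₂ : ∀ q, -1 ≤ ‖g₁ q‖ := fun q => by linarith [norm_nonneg (g₁ q)]
    rw [← sum_wt_mul_logCorrelation_left g₁ hg₁ g₂ ha₁ b₁ a₂ b₂ x ω le_rfl]
    refine (norm_sum_wt_mul_le hθ₁ hθ₂ _ _).trans ?_
    rw [← Finset.sum_filter_add_sum_filter_not _ (fun ω' : Finset ℕ => A₀ ^ 2 ≤ signDist ω' x)]
    -- the exceptional event has probability at most `1/A₀` (Markov)
    have hbad : ∑ ω' ∈ (Icc 1 (a₁ * ⌊x⌋₊ + b₁)).powerset with A₀ ^ 2 ≤ signDist ω' x,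
        wt (fun q => ‖g₁ q‖) (Icc 1 (a₁ * ⌊x⌋₊ + b₁)) ω' *
          ‖logCorrelation (randModel g₁ ω') g₂ a₁ b₁ a₂ b₂ x ω‖ ≤ ε₀ / 4 * Real.log ω := by
      have hM : ∑ ω' ∈ (Icc 1 (a₁ * ⌊x⌋₊ + b₁)).powerset with A₀ ^ 2 ≤ signDist ω' x,
          wt (fun q => ‖g₁ q‖) (Icc 1 (a₁ * ⌊x⌋₊ + b₁)) ω' ≤ A₀ / A₀ ^ 2 :=
        sum_wt_filter_le hθ₁ hθ₂ (Y := fun ω' => signDist ω' x) (fun ω' => signDist_nonneg ω' x)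
          (by positivity) (by rw [sum_wt_mul_signDist g₁ hNx]; exact hD)
      have hM' : A₀ / A₀ ^ 2 ≤ ε₀ / 8 := by
        rw [div_le_iff₀ (by positivity)]
        have h1 := mul_le_mul_of_nonneg_left h8 (by positivity : (0 : ℝ) ≤ ε₀ / 8 * A₀)
        have h2 : ε₀ / 8 * A₀ * (8 / ε₀) = A₀ := by field_simp
        have h3 : ε₀ / 8 * A₀ * A₀ = ε₀ / 8 * A₀ ^ 2 := by ring
        linarith
      calc _ ≤ ∑ ω' ∈ (Icc 1 (a₁ * ⌊x⌋₊ + b₁)).powerset with A₀ ^ 2 ≤ signDist ω' x,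
            wt (fun q => ‖g₁ q‖) (Icc 1 (a₁ * ⌊x⌋₊ + b₁)) ω' * (2 * Real.log ω) := by
            refine Finset.sum_le_sum fun ω' _ => mul_le_mul_of_nonneg_left ?_ (wt_nonneg hθ₁ hθ₂ _ _)
            have := norm_logCorrelation_le_log (randModel g₁ ω') g₂ (norm_randModel_le_one g₁ ω')
              hb₂ a₁ b₁ a₂ b₂ hω1 hωx
            linarith
        _ = (∑ ω' ∈ (Icc 1 (a₁ * ⌊x⌋₊ + b₁)).powerset with A₀ ^ 2 ≤ signDist ω' x,
            wt (fun q => ‖g₁ q‖) (Icc 1 (a₁ * ⌊x⌋₊ + b₁)) ω') * (2 * Real.log ω) := by rw [Finset.sum_mul]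
        _ ≤ (ε₀ / 8) * (2 * Real.log ω) :=
            mul_le_mul_of_nonneg_right (hM.trans hM') (by positivity)
        _ = ε₀ / 4 * Real.log ω := by ring
    -- on the good event the unimodular case applies at level `A/2`
    have hgood : ∑ ω' ∈ (Icc 1 (a₁ * ⌊x⌋₊ + b₁)).powerset with ¬ (A₀ ^ 2 ≤ signDist ω' x),
        wt (fun q => ‖g₁ q‖) (Icc 1 (a₁ * ⌊x⌋₊ + b₁)) ω' *
          ‖logCorrelation (randModel g₁ ω') g₂ a₁ b₁ a₂ b₂ x ω‖ ≤ ε₀ / 2 * Real.log ω := by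
      calc _ ≤ ∑ ω' ∈ (Icc 1 (a₁ * ⌊x⌋₊ + b₁)).powerset with ¬ (A₀ ^ 2 ≤ signDist ω' x),
            wt (fun q => ‖g₁ q‖) (Icc 1 (a₁ * ⌊x⌋₊ + b₁)) ω' * (ε₀ / 2 * Real.log ω) := by
            refine Finset.sum_le_sum fun ω' hω' => mul_le_mul_of_nonneg_left ?_ (wt_nonneg hθ₁ hθ₂ _ _)
            have hY : signDist ω' x ≤ A₀ ^ 2 := (not_le.mp (Finset.mem_filter.mp hω').2).le
            have hnp := nonpretentiousAt_randModel g₁ ω' hb₁ hxpos.le hApos.le hA2A₀ hD hY hhyp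
            exact hA₁ (A / 2) (by linarith) x ω (by linarith) hωx (randModel g₁ ω') g₂
              (isMultiplicative_randModel g₁ ω') hg₂ (norm_randModel_le_one g₁ ω') hb₂
              (isCircleValued_randModel g₁ ω') hP₂ hnp
        _ = (∑ ω' ∈ (Icc 1 (a₁ * ⌊x⌋₊ + b₁)).powerset with ¬ (A₀ ^ 2 ≤ signDist ω' x),
            wt (fun q => ‖g₁ q‖) (Icc 1 (a₁ * ⌊x⌋₊ + b₁)) ω') * (ε₀ / 2 * Real.log ω) := by rw [Finset.sum_mul]
        _ ≤ 1 * (ε₀ / 2 * Real.log ω) := by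
            refine mul_le_mul_of_nonneg_right ?_ (by positivity)
            calc _ ≤ ∑ ω' ∈ (Icc 1 (a₁ * ⌊x⌋₊ + b₁)).powerset, wt (fun q => ‖g₁ q‖) (Icc 1 (a₁ * ⌊x⌋₊ + b₁)) ω' :=
                  Finset.sum_le_sum_of_subset_of_nonneg (Finset.filter_subset _ _)
                    fun ω' _ _ => wt_nonneg hθ₁ hθ₂ _ _
              _ = 1 := sum_wt_eq_one _ _
        _ = ε₀ / 2 * Real.log ω := one_mul _
    linarith

/-- **Engine for the `g₁`-slot, from Halász's inequality** (`Literature.NumberTheory.Sieve.halaszMontgomeryTenenbaum`,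
the input the paper cites: "Applying the Halasz inequality (see e.g. [Tenenbaum] or
[Granville–Soundararajan])"). [cite: TaoFMP2016, Proposition 2.1 (proof)] -/
theorem Tao2016_theorem13For.of_circleValued_left (hH : Sieve.halaszMontgomeryTenenbaum)
    {P₂ : ArithmeticFunction ℂ → Prop} (h : Tao2016_theorem13For IsCircleValued P₂) :
    Tao2016_theorem13For (fun _ => True) P₂ := by
  obtain ⟨C, hC, hMV⟩ := absMeanValueBound_of_halasz hH
  exact Tao2016_theorem13For.of_circleValued_left_of_mv hC hMV h

/-- **Tao 2016, Proposition 2.1, from a mean value bound**: `AbsMeanValueBound C` and Theorem 1.3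
for `S¹`-valued `g₁` give Theorem 1.3 (`Literature.NumberTheory.LFunctions.Tao2016_prop21`). [cite: TaoFMP2016, Proposition 2.1] -/
theorem Tao2016_prop21_of_mv {C : ℝ} (hC : 0 < C) (hMV : AbsMeanValueBound C) : Tao2016_prop21 :=
  fun h => tao_log_averaged_elliott_two_iff.mpr
    (Tao2016_theorem13For.of_circleValued_left_of_mv hC hMV h)

/-- **Tao 2016, Proposition 2.1, PROVED from Halász's inequality**: assuming
`Literature.NumberTheory.Sieve.halaszMontgomeryTenenbaum`, Theorem 1.3 for `S¹`-valued `g₁` implies Theorem 1.3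
(`Literature.NumberTheory.LFunctions.Tao2016_prop21`). [cite: TaoFMP2016, Proposition 2.1] -/
theorem Tao2016_prop21_of_halasz (hH : Sieve.halaszMontgomeryTenenbaum) : Tao2016_prop21 :=
  fun h => tao_log_averaged_elliott_two_iff.mpr (Tao2016_theorem13For.of_circleValued_left hH h)

/-- **Tao 2016, the `g₂`-analogue of Proposition 2.1, PROVED**: Theorem 1.3 for `S¹`-valued
`g₁, g₂` implies Theorem 1.3 for `S¹`-valued `g₁` and arbitrary `g₂` (`Literature.NumberTheory.LFunctions.Tao2016_prop21_right`).
[cite: TaoFMP2016, §2 (paragraph after the proof of Proposition 2.1)] -/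
theorem Tao2016_prop21_right_holds : Tao2016_prop21_right :=
  fun h => Tao2016_theorem13For.of_circleValued_right h

/-- **The §2 reduction from a mean value bound**: with `AbsMeanValueBound C` in place of Halász's
inequality, Propositions 2.1 (both parts, this file) and 2.2 (both parts,
`TaoLogElliottCMization.lean`) give `Literature.NumberTheory.LFunctions.Tao2016_section2_reduction`
(`Tao2016_theorem23 → tao_log_averaged_elliott_two`). [cite: TaoFMP2016, §2 (paragraph before Theorem 2.3)] -/
theorem Tao2016_section2_reduction_of_mv {C : ℝ} (hC : 0 < C) (hMV : AbsMeanValueBound C) :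
    Tao2016_section2_reduction :=
  Tao2016_section2_reduction_of_props (Tao2016_prop21_of_mv hC hMV) Tao2016_prop21_right_holds
    Tao2016_prop22_holds Tao2016_prop22_right_holds

/-- **The §2 reduction from Halász's inequality**: `halaszMontgomeryTenenbaum` implies
`Literature.NumberTheory.LFunctions.Tao2016_section2_reduction`, i.e. Theorem 2.3 implies Theorem 1.3 (all four printed reduction
steps being proved). [cite: TaoFMP2016, §2 (paragraph before Theorem 2.3)] -/
theorem Tao2016_section2_reduction_of_halasz (hH : Sieve.halaszMontgomeryTenenbaum) :
    Tao2016_section2_reduction := by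
  obtain ⟨C, hC, hMV⟩ := absMeanValueBound_of_halasz hH
  exact Tao2016_section2_reduction_of_mv hC hMV

/-- **Theorem 1.3 from Halász's inequality and Theorem 2.3.** [cite: TaoFMP2016, §2] -/
theorem tao_log_averaged_elliott_two_of_halasz (hH : Sieve.halaszMontgomeryTenenbaum)
    (h23 : Tao2016_theorem23) : tao_log_averaged_elliott_two :=
  Tao2016_section2_reduction_of_halasz hH h23

end Literature.NumberTheory.LFunctions
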